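import Literature.LinearAlgebra.Matrix.GerstenhaberNilpotentSubspaceEquality
import Literature.LinearAlgebra.Matrix.NilpotentSumTraceOrthogonality
import HarnessLib

/-!
# Gerstenhaber's theorem, case of equality — the PROOF (discharge of `deSeguinsPazzis2013_equality`)

This file proves, for EVERY field `K` and every `n`, that a linear subspace `V ⊆ Mat_n(K)` of nilpotent
matrices with `dim_K V = binom(n,2)` is similar to `NT_n(K)`:
`theorem deSeguinsPazzis2013_equality_holds : deSeguinsPazzis2013_equality`, the named fact typed in the
sibling file `GerstenhaberNilpotentSubspaceEquality.lean` (whose conditional corollaries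
`exists_sqZero_subspace_of_equality`, `exists_sqZero_of_equality_four` thereby become unconditional by
feeding them `deSeguinsPazzis2013_equality_holds`).

Source (held, read at the page): [dSP13] = C. de Seguins Pazzis, *On Gerstenhaber's theorem for spaces
of nilpotent matrices over a skew field*, Linear Algebra Appl. 438 (2013) 4426–4438, arXiv:1210.4951
[deSeguinsPazzis2013Gerstenhaber], **§4 "Solving the case of equality"** (pp. 6–9 of the arXiv
version), specialised to a COMMUTATIVE field (`𝕂 = 𝕂₀`, `q = 1`), and **Lemma 4** (p. 3).  The theorem
is M. Gerstenhaber, Amer. J. Math. 80 (1958) 614–622, Thm. 2 (`#K ≥ n`); all fields: V.N. Serezhkin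
1985; the proof followed here is de Seguins Pazzis's (every field, every `n`).

"Theorem 1 (Gerstenhaber, Serezhkin). Assume that `𝕂` is commutative, and let `𝒱` be a nilpotent
linear subspace of `Mat_n(𝕂)`. Then `dim 𝒱 ≤ binom(n,2)`, and equality occurs if and only if `𝒱` is
similar to `NT_n(𝕂)`."  The inequality and Lemma 5 (adapted vectors) are the tree's
`GerstenhaberNilpotentSubspace.lean` (`finrank_le_choose_two`, `exists_adapted`), both used here.

## Architecture (mirrors [dSP13] §4; deviations flagged)

* **Lemma 4** (`tr(AB) = 0` for `A, B` in a nilpotent linear subspace, every field) is IMPORTED from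
  the sibling file `NilpotentSumTraceOrthogonality.lean` (`trace_mul_eq_zero_of_mem`, the printed `c₂`
  argument made characteristic-free through the second compound matrix); it is used in Remark 2,
  Claim 4 (case `#K = 2`) and §4.7.2 below.
* Block calculus on `Fin (m+2) = {0} ⊔ middle ⊔ {last}`: `blk a r b c T d e s z = [[a,r,b],[c,T,d],[e,s,z]]`
  with the nine-block product `blk_mul_blk`; the compressions `ulL` (`K(M)`), `lrL` (`I(M)`), `lastColL`
  (`C(M)`), `topRowL` (`R(M)`); similarity `conjL P : A ↦ P A P⁻¹` by a unit; the shears `lshear`, `bshear`,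
  permutation units `permUnit`, block-diagonal units `ldiag`.
* **§4.1** (`n = 2`) and `n ≤ 1`: `IsPreNormalized.two`, and the trivial cases in the main induction.
* **§4.2** (Stage 0, `exists_isPreNormalized`): an adapted index (Lemma 5, the tree's `exists_adapted`),
  moved last by a permutation, then `K(W₁)` has dimension `binom(n−1,2)` (inequality at `n−1` + rank–nullity),
  the induction hypothesis conjugates it to `NT_{n−1}` by `Q ⊕ 1` (`ldiag`): the predicate `IsPreNormalized`
  records (A'), (B) of the paper.
* **§4.3** (Stage 1, `IsPreNormalized.exists_isNormalized`): `e₁` is adapted for `𝒱ᵀ`; `I(W₂)` has dimension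
  `binom(n−1,2)`; **Claim 1**: the conjugator may be taken to be a lower shear `[[I,0],[L₁,1]]` (type-(C) and
  type-(U) matrices), giving (C') — the predicate `IsNormalized`.
* **§4.4** (Stage 2): the families `A_L` (`f(L)`, `φ(L)`), `B_C` (`ψ(C)`, `g(C)`), `E_U` (`h(U)`);
  **Claim 2** (`LC = 0 ⇒ φ(L)C = 0 = Lψ(C)`, from the zero corner of `(A_L+B_C)²`); **Claim 3**
  (`φ = λ·id`, `ψ = −λ·id`) — DEVIATION: derived from Claim 2 together with the bilinear identity
  `Lψ(C) + φ(L)C = 0`, which is Remark 2 of the paper (`tr(A_L B_C) = 0`, Lemma 4), instead of the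
  printed elementary-operations argument; then conjugation by the shear `bshear (−λ) 0` kills `φ, ψ`
  (`exists_clean`).
* **§4.5 Claim 4** (`f = 0`, `g = 0`) AS PRINTED, three cases: `n ≥ 4`; `n = 3, #K > 2`; `n = 3, #K = 2`
  (the matrices `A, B, J`, the traces `tr(AJ) = tr(BJ) = tr(J) = 0` and the three determinants
  `det(J + xA + yB)`, `(x,y) ∈ {(0,0),(1,0),(0,1)}`).  **§4.6 Claim 5** (`h = 0`) — for all `U` at once.
  **§4.7** `J_a ∈ 𝒱` normalised via traces against `A_L, B_C, E_U` (Lemma 4) and `M³`; **§4.8** `𝒱 ⊇ NT_n`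
  and equality by dimension (`finrank_nt`, from the sibling file's `finrank_eq_choose_two_of_forall_mem_iff`).
* Main statement `exists_eq_nt_map_conjL` (strong induction on `n`; the hypothesis at `n−1` is used in
  Stage 0 and in Claim 1, as in the paper), `exists_forall_mem_iff_mem_nt`, and the discharge
  `deSeguinsPazzis2013_equality_holds` (`P⁻¹` there is Mathlib's nonsingular inverse; for a unit it is the
  group inverse).

Definitions introduced (all with bodies, proof vocabulary only): `nt K n` (`NT_n(K)` = `{A | IsStrictUpper A}`
as a `Submodule`), the block constructors `blk`, `hblk`,
`lblk`, the compressions `ulL`, `lrL`, `lastColL`, `topRowL`, `conjL`, the units `lshear`, `bshear`,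
`permUnit`, `ldiag`, and the two bookkeeping predicates `IsPreNormalized`, `IsNormalized`.
No instance, no notation, NO named fact (net debt: −1, the sibling's fact is discharged).
This file proves a published linear-algebra theorem; it proves no summit statement.
-/


open Matrix

namespace Literature.LinearAlgebra.Matrix.GerstenhaberNilpotentSubspace

variable {K : Type*} [Field K]

/-! ## The space `NT_n(K)` of strictly upper-triangular matrices -/

/-- `NT_n(K)`: the linear subspace of strictly upper-triangular `n × n` matrices over `K` (the tree's
predicate `IsStrictUpper`: the entries `(i, j)` with `j ≤ i` vanish), bundled as a `Submodule`.
[cite: deSeguinsPazzis2013Gerstenhaber, §1 (notation `NT_n(𝕂)`)] -/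
def nt (K : Type*) [Field K] (n : ℕ) : Submodule K (Matrix (Fin n) (Fin n) K) where
  carrier := {A | IsStrictUpper A}
  add_mem' := fun {A B} hA hB i j hij => by rw [Matrix.add_apply, hA i j hij, hB i j hij, add_zero]
  zero_mem' := fun _ _ _ => rfl
  smul_mem' := fun c {A} hA i j hij => by rw [Matrix.smul_apply, hA i j hij, smul_zero]

/-- Membership in `NT_n(K)`, unfolded. [cite: deSeguinsPazzis2013Gerstenhaber, §1] -/
theorem mem_nt {n : ℕ} {A : Matrix (Fin n) (Fin n) K} :
    A ∈ nt K n ↔ ∀ i j : Fin n, j ≤ i → A i j = 0 :=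
  Iff.rfl

/-- Membership in `NT_n(K)` is the predicate `IsStrictUpper`. [cite: deSeguinsPazzis2013Gerstenhaber, §1] -/
theorem mem_nt_iff_isStrictUpper {n : ℕ} {A : Matrix (Fin n) (Fin n) K} : A ∈ nt K n ↔ IsStrictUpper A :=
  Iff.rfl

/-! ## Block calculus on `Fin (m + 2)` : first index, middle indices, last index -/

section Blocks

variable {m : ℕ}

/-- The `i`-th middle index of `Fin (m+2)` (the indices strictly between `0` and `Fin.last (m+1)`). [folklore] -/
private def md (i : Fin m) : Fin (m + 2) := i.castSucc.succ

/-- Proof plumbing (block calculus / bookkeeping). [folklore] -/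
private theorem md_ne_zero (i : Fin m) : md i ≠ 0 := Fin.succ_ne_zero _

/-- Proof plumbing (block calculus / bookkeeping). [folklore] -/
private theorem zero_lt_md (i : Fin m) : (0 : Fin (m + 2)) < md i := Fin.succ_pos _

/-- Proof plumbing (block calculus / bookkeeping). [folklore] -/
private theorem md_lt_last (i : Fin m) : md i < Fin.last (m + 1) := by
  rw [md, ← Fin.succ_last, Fin.succ_lt_succ_iff]; exact Fin.castSucc_lt_last i

/-- Proof plumbing (block calculus / bookkeeping). [folklore] -/
private theorem md_ne_last (i : Fin m) : md i ≠ Fin.last (m + 1) := (md_lt_last i).ne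

/-- Proof plumbing (block calculus / bookkeeping). [folklore] -/
private theorem last_ne_md (i : Fin m) : Fin.last (m + 1) ≠ md i := (md_ne_last i).symm

/-- Proof plumbing (block calculus / bookkeeping). [folklore] -/
private theorem zero_ne_last : (0 : Fin (m + 2)) ≠ Fin.last (m + 1) := (Fin.last_pos).ne

/-- Proof plumbing (block calculus / bookkeeping). [folklore] -/
private theorem last_ne_zero : Fin.last (m + 1) ≠ (0 : Fin (m + 2)) := (Fin.last_pos).ne'

/-- Proof plumbing (block calculus / bookkeeping). [folklore] -/
private theorem md_injective : Function.Injective (md (m := m)) :=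
  fun _ _ h => Fin.castSucc_injective _ (Fin.succ_injective _ h)

/-- Proof plumbing (block calculus / bookkeeping). [folklore] -/
private theorem md_inj {i j : Fin m} : md i = md j ↔ i = j := md_injective.eq_iff

/-- Proof plumbing (block calculus / bookkeeping). [folklore] -/
private theorem md_lt_md {i j : Fin m} : md i < md j ↔ i < j := by
  rw [md, md, Fin.succ_lt_succ_iff, Fin.castSucc_lt_castSucc_iff]

/-- Proof plumbing (block calculus / bookkeeping). [folklore] -/
private theorem md_le_md {i j : Fin m} : md i ≤ md j ↔ i ≤ j := by
  rw [md, md, Fin.succ_le_succ_iff, Fin.castSucc_le_castSucc_iff]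

/-- Proof plumbing (block calculus / bookkeeping). [folklore] -/
private theorem fin_trichotomy (j : Fin (m + 2)) : j = 0 ∨ (∃ i, j = md i) ∨ j = Fin.last (m + 1) := by
  rcases Fin.eq_zero_or_eq_succ j with rfl | ⟨k, rfl⟩
  · exact Or.inl rfl
  · rcases Fin.eq_castSucc_or_eq_last k with ⟨i, rfl⟩ | rfl
    · exact Or.inr (Or.inl ⟨i, rfl⟩)
    · exact Or.inr (Or.inr (Fin.succ_last m))

/-- Three-way split of a sum over `Fin (m+2)`. [folklore] -/
private theorem sum3 {α : Type*} [AddCommMonoid α] (f : Fin (m + 2) → α) :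
    ∑ j, f j = f 0 + ∑ i, f (md i) + f (Fin.last (m + 1)) := by
  rw [Fin.sum_univ_succ, Fin.sum_univ_castSucc]
  exact (add_assoc _ _ _).symm

/-- The vector `(x, v, y)` on `Fin (m+2)`. [folklore] -/
private def vec3 {α : Type*} (x : α) (v : Fin m → α) (y : α) : Fin (m + 2) → α := Fin.cons x (Fin.snoc v y)

/-- Proof plumbing (block calculus / bookkeeping). [folklore] -/
@[simp] private theorem vec3_zero {α : Type*} (x : α) (v : Fin m → α) (y : α) : vec3 x v y 0 = x := rfl

/-- Proof plumbing (block calculus / bookkeeping). [folklore] -/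
@[simp] private theorem vec3_md {α : Type*} (x : α) (v : Fin m → α) (y : α) (i : Fin m) :
    vec3 x v y (md i) = v i := by
  simp [vec3, md]

/-- Proof plumbing (block calculus / bookkeeping). [folklore] -/
@[simp] private theorem vec3_last {α : Type*} (x : α) (v : Fin m → α) (y : α) :
    vec3 x v y (Fin.last (m + 1)) = y := by
  rw [← Fin.succ_last]; simp [vec3]

/-- The `3 × 3` block matrix `[[a, r, b], [c, T, d], [e, s, z]]` on `Fin (m+2)` for the decomposition
first index / middle indices / last index (corners are scalars). [cite: deSeguinsPazzis2013Gerstenhaber, §4.3 Remark 1] -/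
def blk {α : Type*} (a : α) (r : Fin m → α) (b : α) (c : Fin m → α) (T : Matrix (Fin m) (Fin m) α)
    (d : Fin m → α) (e : α) (s : Fin m → α) (z : α) : Matrix (Fin (m + 2)) (Fin (m + 2)) α :=
  Matrix.of (vec3 (vec3 a r b) (fun k => vec3 (c k) (T k) (d k)) (vec3 e s z))

section blk_apply
variable {α : Type*} (a : α) (r : Fin m → α) (b : α) (c : Fin m → α) (T : Matrix (Fin m) (Fin m) α)
    (d : Fin m → α) (e : α) (s : Fin m → α) (z : α)

/-- Proof plumbing (block calculus / bookkeeping). [folklore] -/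
@[simp] private theorem blk_zz : blk a r b c T d e s z 0 0 = a := by simp [blk]
/-- Proof plumbing (block calculus / bookkeeping). [folklore] -/
@[simp] private theorem blk_zm (j : Fin m) : blk a r b c T d e s z 0 (md j) = r j := by simp [blk]
/-- Proof plumbing (block calculus / bookkeeping). [folklore] -/
@[simp] private theorem blk_zl : blk a r b c T d e s z 0 (Fin.last (m + 1)) = b := by simp [blk]
/-- Proof plumbing (block calculus / bookkeeping). [folklore] -/
@[simp] private theorem blk_mz (i : Fin m) : blk a r b c T d e s z (md i) 0 = c i := by simp [blk]
/-- Proof plumbing (block calculus / bookkeeping). [folklore] -/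
@[simp] private theorem blk_mm (i j : Fin m) : blk a r b c T d e s z (md i) (md j) = T i j := by simp [blk]
/-- Proof plumbing (block calculus / bookkeeping). [folklore] -/
@[simp] private theorem blk_ml (i : Fin m) : blk a r b c T d e s z (md i) (Fin.last (m + 1)) = d i := by
  simp [blk]
/-- Proof plumbing (block calculus / bookkeeping). [folklore] -/
@[simp] private theorem blk_lz : blk a r b c T d e s z (Fin.last (m + 1)) 0 = e := by simp [blk]
/-- Proof plumbing (block calculus / bookkeeping). [folklore] -/
@[simp] private theorem blk_lm (j : Fin m) : blk a r b c T d e s z (Fin.last (m + 1)) (md j) = s j := by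
  simp [blk]
/-- Proof plumbing (block calculus / bookkeeping). [folklore] -/
@[simp] private theorem blk_ll : blk a r b c T d e s z (Fin.last (m + 1)) (Fin.last (m + 1)) = z := by
  simp [blk]

end blk_apply

/-- Every matrix on `Fin (m+2)` is the block matrix of its nine blocks. [folklore] -/
private theorem blk_eta {α : Type*} (M : Matrix (Fin (m + 2)) (Fin (m + 2)) α) :
    M = blk (M 0 0) (fun j => M 0 (md j)) (M 0 (Fin.last (m + 1))) (fun i => M (md i) 0)
      (fun i j => M (md i) (md j)) (fun i => M (md i) (Fin.last (m + 1))) (M (Fin.last (m + 1)) 0)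
      (fun j => M (Fin.last (m + 1)) (md j)) (M (Fin.last (m + 1)) (Fin.last (m + 1))) := by
  ext i j
  rcases fin_trichotomy i with rfl | ⟨i, rfl⟩ | rfl <;>
    rcases fin_trichotomy j with rfl | ⟨j, rfl⟩ | rfl <;> simp

/-- Two block matrices are equal iff their blocks are. [folklore] -/
private theorem blk_inj {α : Type*} {a a' b b' e e' z z' : α} {r r' c c' d d' s s' : Fin m → α}
    {T T' : Matrix (Fin m) (Fin m) α} :
    blk a r b c T d e s z = blk a' r' b' c' T' d' e' s' z' ↔
      a = a' ∧ r = r' ∧ b = b' ∧ c = c' ∧ T = T' ∧ d = d' ∧ e = e' ∧ s = s' ∧ z = z' := by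
  constructor
  · intro h
    have h' := fun i j => congrFun (congrFun h i) j
    refine ⟨by simpa using h' 0 0, funext fun j => by simpa using h' 0 (md j),
      by simpa using h' 0 (Fin.last _), funext fun i => by simpa using h' (md i) 0,
      Matrix.ext fun i j => by simpa using h' (md i) (md j),
      funext fun i => by simpa using h' (md i) (Fin.last _), by simpa using h' (Fin.last _) 0,
      funext fun j => by simpa using h' (Fin.last _) (md j), by simpa using h' (Fin.last _) (Fin.last _)⟩
  · rintro ⟨rfl, rfl, rfl, rfl, rfl, rfl, rfl, rfl, rfl⟩; rfl

/-- Proof plumbing (block calculus / bookkeeping). [folklore] -/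
private theorem blk_add (a a' b b' e e' z z' : K) (r r' c c' d d' s s' : Fin m → K)
    (T T' : Matrix (Fin m) (Fin m) K) :
    blk a r b c T d e s z + blk a' r' b' c' T' d' e' s' z' =
      blk (a + a') (r + r') (b + b') (c + c') (T + T') (d + d') (e + e') (s + s') (z + z') := by
  ext i j
  rcases fin_trichotomy i with rfl | ⟨i, rfl⟩ | rfl <;>
    rcases fin_trichotomy j with rfl | ⟨j, rfl⟩ | rfl <;> simp

/-- Proof plumbing (block calculus / bookkeeping). [folklore] -/
private theorem blk_sub (a a' b b' e e' z z' : K) (r r' c c' d d' s s' : Fin m → K)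
    (T T' : Matrix (Fin m) (Fin m) K) :
    blk a r b c T d e s z - blk a' r' b' c' T' d' e' s' z' =
      blk (a - a') (r - r') (b - b') (c - c') (T - T') (d - d') (e - e') (s - s') (z - z') := by
  ext i j
  rcases fin_trichotomy i with rfl | ⟨i, rfl⟩ | rfl <;>
    rcases fin_trichotomy j with rfl | ⟨j, rfl⟩ | rfl <;> simp

/-- Proof plumbing (block calculus / bookkeeping). [folklore] -/
private theorem blk_smul (t a b e z : K) (r c d s : Fin m → K) (T : Matrix (Fin m) (Fin m) K) :
    t • blk a r b c T d e s z = blk (t * a) (t • r) (t * b) (t • c) (t • T) (t • d) (t * e) (t • s) (t * z) := by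
  ext i j
  rcases fin_trichotomy i with rfl | ⟨i, rfl⟩ | rfl <;>
    rcases fin_trichotomy j with rfl | ⟨j, rfl⟩ | rfl <;> simp

/-- Proof plumbing (block calculus / bookkeeping). [folklore] -/
private theorem blk_zero : blk (0 : K) (0 : Fin m → K) 0 0 0 0 0 0 0 = 0 := by
  ext i j
  rcases fin_trichotomy i with rfl | ⟨i, rfl⟩ | rfl <;>
    rcases fin_trichotomy j with rfl | ⟨j, rfl⟩ | rfl <;> simp

/-- Block multiplication rule for `[[a, r, b], [c, T, d], [e, s, z]]`. [folklore] -/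
private theorem blk_mul_blk (a a' b b' e e' z z' : K) (r r' c c' d d' s s' : Fin m → K)
    (T T' : Matrix (Fin m) (Fin m) K) :
    blk a r b c T d e s z * blk a' r' b' c' T' d' e' s' z' =
      blk (a * a' + r ⬝ᵥ c' + b * e') (a • r' + r ᵥ* T' + b • s') (a * b' + r ⬝ᵥ d' + b * z')
        (a' • c + T *ᵥ c' + e' • d) (vecMulVec c r' + T * T' + vecMulVec d s')
        (b' • c + T *ᵥ d' + z' • d)
        (e * a' + s ⬝ᵥ c' + z * e') (e • r' + s ᵥ* T' + z • s') (e * b' + s ⬝ᵥ d' + z * z') := by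
  ext i j
  rw [Matrix.mul_apply, sum3]
  rcases fin_trichotomy i with rfl | ⟨i, rfl⟩ | rfl <;>
    rcases fin_trichotomy j with rfl | ⟨j, rfl⟩ | rfl <;>
    simp [dotProduct, Matrix.vecMul, Matrix.mulVec, Matrix.mul_apply, vecMulVec_apply, mul_comm]

/-- Trace of a block matrix. [folklore] -/
private theorem trace_blk (a b e z : K) (r c d s : Fin m → K) (T : Matrix (Fin m) (Fin m) K) :
    Matrix.trace (blk a r b c T d e s z) = a + Matrix.trace T + z := by
  rw [Matrix.trace, Matrix.trace, sum3]
  simp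

/-- Membership of a block matrix in `NT_{m+2}(K)`. [folklore] -/
private theorem blk_mem_nt {a b e z : K} {r c d s : Fin m → K} {T : Matrix (Fin m) (Fin m) K} :
    blk a r b c T d e s z ∈ nt K (m + 2) ↔ a = 0 ∧ c = 0 ∧ T ∈ nt K m ∧ e = 0 ∧ s = 0 ∧ z = 0 := by
  constructor
  · intro h
    refine ⟨by simpa using h 0 0 le_rfl, funext fun i => by simpa using h (md i) 0 (zero_lt_md i).le,
      fun i j hij => by simpa using h (md i) (md j) (md_le_md.2 hij),
      by simpa using h (Fin.last _) 0 (Fin.last_pos).le,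
      funext fun j => by simpa using h (Fin.last _) (md j) (md_lt_last j).le,
      by simpa using h (Fin.last _) (Fin.last _) le_rfl⟩
  · rintro ⟨rfl, rfl, hT, rfl, rfl, rfl⟩ i j hij
    rcases fin_trichotomy i with rfl | ⟨i, rfl⟩ | rfl <;>
      rcases fin_trichotomy j with rfl | ⟨j, rfl⟩ | rfl
    · simp
    · exact absurd hij (not_le.2 (zero_lt_md j))
    · exact absurd hij (not_le.2 Fin.last_pos)
    · simp
    · simpa using hT i j (md_le_md.1 hij)
    · exact absurd hij (not_le.2 (md_lt_last i))
    · simp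
    · simp
    · simp

end Blocks

/-! ## Nilpotent matrices with an isolated row or column -/

/-- If row `i₀` of `N` vanishes off the diagonal, then `(N^k)_{i₀ i₀} = (N_{i₀ i₀})^k`. [folklore] -/
private theorem pow_apply_diag_of_row {ι : Type*} [Fintype ι] [DecidableEq ι] (N : Matrix ι ι K) (i₀ : ι)
    (hrow : ∀ j, j ≠ i₀ → N i₀ j = 0) (k : ℕ) : (N ^ k) i₀ i₀ = (N i₀ i₀) ^ k := by
  induction k with
  | zero => simp
  | succ k ih =>
    rw [pow_succ', Matrix.mul_apply, Finset.sum_eq_single i₀, ih, pow_succ']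
    · intro j _ hj; rw [hrow j hj, zero_mul]
    · intro h; exact absurd (Finset.mem_univ _) h

/-- If column `i₀` of `N` vanishes off the diagonal, then `(N^k)_{i₀ i₀} = (N_{i₀ i₀})^k`. [folklore] -/
private theorem pow_apply_diag_of_col {ι : Type*} [Fintype ι] [DecidableEq ι] (N : Matrix ι ι K) (i₀ : ι)
    (hcol : ∀ j, j ≠ i₀ → N j i₀ = 0) (k : ℕ) : (N ^ k) i₀ i₀ = (N i₀ i₀) ^ k := by
  induction k with
  | zero => simp
  | succ k ih =>
    rw [pow_succ, Matrix.mul_apply, Finset.sum_eq_single i₀, ih, pow_succ]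
    · intro j _ hj; rw [hcol j hj, mul_zero]
    · intro h; exact absurd (Finset.mem_univ _) h

/-- A nilpotent matrix whose row `i₀` vanishes off the diagonal has `N_{i₀ i₀} = 0`. [folklore] -/
private theorem apply_diag_eq_zero_of_row {ι : Type*} [Fintype ι] [DecidableEq ι] {N : Matrix ι ι K} (i₀ : ι)
    (hrow : ∀ j, j ≠ i₀ → N i₀ j = 0) (hN : IsNilpotent N) : N i₀ i₀ = 0 := by
  obtain ⟨k, hk⟩ := hN
  have h := pow_apply_diag_of_row N i₀ hrow k
  rw [hk, Matrix.zero_apply] at h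
  exact IsNilpotent.eq_zero ⟨k, h.symm⟩

/-- A nilpotent matrix whose column `i₀` vanishes off the diagonal has `N_{i₀ i₀} = 0`. [folklore] -/
private theorem apply_diag_eq_zero_of_col {ι : Type*} [Fintype ι] [DecidableEq ι] {N : Matrix ι ι K} (i₀ : ι)
    (hcol : ∀ j, j ≠ i₀ → N j i₀ = 0) (hN : IsNilpotent N) : N i₀ i₀ = 0 := by
  obtain ⟨k, hk⟩ := hN
  have h := pow_apply_diag_of_col N i₀ hcol k
  rw [hk, Matrix.zero_apply] at h
  exact IsNilpotent.eq_zero ⟨k, h.symm⟩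

/-! ## Conjugation -/

/-- Conjugation `A ↦ P A P⁻¹` by an invertible matrix, as a linear automorphism (similarity
`𝒱 ↦ P 𝒱 P⁻¹` preserves nilpotency and dimension, [dSP13] §1). [cite: deSeguinsPazzis2013Gerstenhaber, §1] -/
def conjL {ι : Type*} [Fintype ι] [DecidableEq ι] (P : (Matrix ι ι K)ˣ) :
    Matrix ι ι K ≃ₗ[K] Matrix ι ι K where
  toFun A := (P : Matrix ι ι K) * A * ((P⁻¹ : (Matrix ι ι K)ˣ) : Matrix ι ι K)
  invFun A := ((P⁻¹ : (Matrix ι ι K)ˣ) : Matrix ι ι K) * A * P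
  map_add' A B := by rw [mul_add, add_mul]
  map_smul' t A := by rw [Matrix.mul_smul, Matrix.smul_mul, RingHom.id_apply]
  left_inv A := by
    show ((P⁻¹ : (Matrix ι ι K)ˣ) : Matrix ι ι K) * ((P : Matrix ι ι K) * A * ((P⁻¹ : (Matrix ι ι K)ˣ) : Matrix ι ι K))
      * P = A
    rw [← mul_assoc, ← mul_assoc, Units.inv_mul, one_mul, mul_assoc, Units.inv_mul, mul_one]
  right_inv A := by
    show (P : Matrix ι ι K) * (((P⁻¹ : (Matrix ι ι K)ˣ) : Matrix ι ι K) * A * P)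
      * ((P⁻¹ : (Matrix ι ι K)ˣ) : Matrix ι ι K) = A
    rw [← mul_assoc, ← mul_assoc, Units.mul_inv, one_mul, mul_assoc, Units.mul_inv, mul_one]

section conj
variable {ι : Type*} [Fintype ι] [DecidableEq ι]

/-- Unfolding `conjL`. [cite: deSeguinsPazzis2013Gerstenhaber, §1] -/
theorem conjL_apply (P : (Matrix ι ι K)ˣ) (A : Matrix ι ι K) :
    conjL P A = (P : Matrix ι ι K) * A * ((P⁻¹ : (Matrix ι ι K)ˣ) : Matrix ι ι K) := rfl

/-- Unfolding `conjL⁻¹`. [cite: deSeguinsPazzis2013Gerstenhaber, §1] -/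
theorem conjL_symm_apply (P : (Matrix ι ι K)ˣ) (A : Matrix ι ι K) :
    (conjL P).symm A = ((P⁻¹ : (Matrix ι ι K)ˣ) : Matrix ι ι K) * A * P := rfl

/-- `(P A P⁻¹)^k = P A^k P⁻¹`. [cite: deSeguinsPazzis2013Gerstenhaber, §1] -/
theorem conjL_pow (P : (Matrix ι ι K)ˣ) (A : Matrix ι ι K) (k : ℕ) :
    (conjL P A) ^ k = conjL P (A ^ k) := by
  induction k with
  | zero => rw [pow_zero, pow_zero, conjL_apply, mul_one, Units.mul_inv]
  | succ k ih =>
    rw [pow_succ, ih, conjL_apply, conjL_apply, conjL_apply, pow_succ]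
    simp only [mul_assoc]
    rw [← mul_assoc ((P⁻¹ : (Matrix ι ι K)ˣ) : Matrix ι ι K) (P : Matrix ι ι K), Units.inv_mul, one_mul]

/-- Conjugation preserves nilpotency. [cite: deSeguinsPazzis2013Gerstenhaber, §1] -/
theorem isNilpotent_conjL_iff (P : (Matrix ι ι K)ˣ) (A : Matrix ι ι K) :
    IsNilpotent (conjL P A) ↔ IsNilpotent A := by
  constructor
  · rintro ⟨k, hk⟩
    refine ⟨k, ?_⟩
    rw [conjL_pow] at hk
    simpa using congrArg (conjL P).symm hk
  · rintro ⟨k, hk⟩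
    exact ⟨k, by rw [conjL_pow, hk, map_zero]⟩

/-- Conjugation by `1` is the identity. [cite: deSeguinsPazzis2013Gerstenhaber, §1] -/
theorem conjL_one' : conjL (1 : (Matrix ι ι K)ˣ) = LinearEquiv.refl K _ := by
  apply LinearEquiv.ext; intro A; simp [conjL_apply]

/-- Conjugation is multiplicative. [cite: deSeguinsPazzis2013Gerstenhaber, §1] -/
theorem conjL_mul (P Q : (Matrix ι ι K)ˣ) : conjL (P * Q) = (conjL Q).trans (conjL P) := by
  apply LinearEquiv.ext; intro A
  simp only [conjL_apply, LinearEquiv.trans_apply, Units.val_mul, _root_.mul_inv_rev, mul_assoc]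

/-- Iterated similarity. [cite: deSeguinsPazzis2013Gerstenhaber, §1] -/
theorem map_conjL_map_conjL (P Q : (Matrix ι ι K)ˣ) (V : Submodule K (Matrix ι ι K)) :
    (V.map (conjL Q : Matrix ι ι K →ₗ[K] Matrix ι ι K)).map (conjL P : Matrix ι ι K →ₗ[K] Matrix ι ι K)
      = V.map (conjL (P * Q) : Matrix ι ι K →ₗ[K] Matrix ι ι K) := by
  rw [← Submodule.map_comp]
  congr 1
  apply LinearMap.ext
  intro A
  simp only [LinearMap.coe_comp, Function.comp_apply, LinearEquiv.coe_coe, conjL_apply, _root_.mul_inv_rev,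
    Units.val_mul, mul_assoc]

/-- Similarity by `P` then `P⁻¹`. [cite: deSeguinsPazzis2013Gerstenhaber, §1] -/
theorem map_conjL_inv_map_conjL (P : (Matrix ι ι K)ˣ) (V : Submodule K (Matrix ι ι K)) :
    (V.map (conjL P : Matrix ι ι K →ₗ[K] Matrix ι ι K)).map (conjL P⁻¹ : Matrix ι ι K →ₗ[K] Matrix ι ι K)
      = V := by
  rw [map_conjL_map_conjL, inv_mul_cancel, conjL_one']
  exact Submodule.map_id V

/-- A nilpotent subspace stays nilpotent under similarity. [cite: deSeguinsPazzis2013Gerstenhaber, §1] -/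
theorem forall_isNilpotent_map_conjL (P : (Matrix ι ι K)ˣ) {V : Submodule K (Matrix ι ι K)}
    (hV : ∀ A ∈ V, IsNilpotent A) :
    ∀ A ∈ V.map (conjL P : Matrix ι ι K →ₗ[K] Matrix ι ι K), IsNilpotent A := by
  rintro A ⟨B, hB, rfl⟩
  exact (isNilpotent_conjL_iff P B).2 (hV B hB)

/-- Similarity preserves the dimension. [cite: deSeguinsPazzis2013Gerstenhaber, §1] -/
theorem finrank_map_conjL (P : (Matrix ι ι K)ˣ) (V : Submodule K (Matrix ι ι K)) :
    Module.finrank K (V.map (conjL P : Matrix ι ι K →ₗ[K] Matrix ι ι K)) = Module.finrank K V :=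
  LinearEquiv.finrank_map_eq _ _

end conj

/-! ## Two-block calculus on `Fin (p + 1)`: head split `(1 | p)` and last split `(p | 1)` -/

section Blocks2

variable {p : ℕ}

/-- The block matrix `[[a, r], [c, T]]` on `Fin (p+1)` (first index | the rest), the shape
`M = [[b(M), R(M)], [?, I(M)]]` of [dSP13] §4.3. [cite: deSeguinsPazzis2013Gerstenhaber, §4.3] -/
def hblk {α : Type*} (a : α) (r : Fin p → α) (c : Fin p → α) (T : Matrix (Fin p) (Fin p) α) :
    Matrix (Fin (p + 1)) (Fin (p + 1)) α :=
  Matrix.of (Fin.cons (Fin.cons a r) (fun i => Fin.cons (c i) (T i)))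

/-- The block matrix `[[T, d], [s, z]]` on `Fin (p+1)` (the rest | last index), the shape
`M = [[K(M), C(M)], [L(M), a(M)]]` of [dSP13] §3. [cite: deSeguinsPazzis2013Gerstenhaber, §3] -/
def lblk {α : Type*} (T : Matrix (Fin p) (Fin p) α) (d : Fin p → α) (s : Fin p → α) (z : α) :
    Matrix (Fin (p + 1)) (Fin (p + 1)) α :=
  Matrix.of (Fin.snoc (fun i => (Fin.snoc (T i) (d i) : Fin (p + 1) → α)) (Fin.snoc s z))

section apply2
variable {α : Type*} (a : α) (r c : Fin p → α) (T : Matrix (Fin p) (Fin p) α) (d s : Fin p → α) (z : α)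

/-- Proof plumbing (block calculus / bookkeeping). [folklore] -/
@[simp] private theorem hblk_zz : hblk a r c T 0 0 = a := rfl
/-- Proof plumbing (block calculus / bookkeeping). [folklore] -/
@[simp] private theorem hblk_zs (j : Fin p) : hblk a r c T 0 j.succ = r j := by simp [hblk]
/-- Proof plumbing (block calculus / bookkeeping). [folklore] -/
@[simp] private theorem hblk_sz (i : Fin p) : hblk a r c T i.succ 0 = c i := by simp [hblk]
/-- Proof plumbing (block calculus / bookkeeping). [folklore] -/
@[simp] private theorem hblk_ss (i j : Fin p) : hblk a r c T i.succ j.succ = T i j := by simp [hblk]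
/-- Proof plumbing (block calculus / bookkeeping). [folklore] -/
@[simp] private theorem lblk_cc (i j : Fin p) : lblk T d s z i.castSucc j.castSucc = T i j := by simp [lblk]
/-- Proof plumbing (block calculus / bookkeeping). [folklore] -/
@[simp] private theorem lblk_cl (i : Fin p) : lblk T d s z i.castSucc (Fin.last p) = d i := by simp [lblk]
/-- Proof plumbing (block calculus / bookkeeping). [folklore] -/
@[simp] private theorem lblk_lc (j : Fin p) : lblk T d s z (Fin.last p) j.castSucc = s j := by simp [lblk]
/-- Proof plumbing (block calculus / bookkeeping). [folklore] -/
@[simp] private theorem lblk_ll : lblk T d s z (Fin.last p) (Fin.last p) = z := by simp [lblk]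

end apply2

/-- Proof plumbing (block calculus / bookkeeping). [folklore] -/
private theorem hblk_eta {α : Type*} (N : Matrix (Fin (p + 1)) (Fin (p + 1)) α) :
    N = hblk (N 0 0) (fun j => N 0 j.succ) (fun i => N i.succ 0) (fun i j => N i.succ j.succ) := by
  ext i j
  rcases Fin.eq_zero_or_eq_succ i with rfl | ⟨i, rfl⟩ <;>
    rcases Fin.eq_zero_or_eq_succ j with rfl | ⟨j, rfl⟩ <;> simp

/-- Proof plumbing (block calculus / bookkeeping). [folklore] -/
private theorem lblk_eta {α : Type*} (N : Matrix (Fin (p + 1)) (Fin (p + 1)) α) :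
    N = lblk (fun i j => N i.castSucc j.castSucc) (fun i => N i.castSucc (Fin.last p))
      (fun j => N (Fin.last p) j.castSucc) (N (Fin.last p) (Fin.last p)) := by
  ext i j
  rcases Fin.eq_castSucc_or_eq_last i with ⟨i, rfl⟩ | rfl <;>
    rcases Fin.eq_castSucc_or_eq_last j with ⟨j, rfl⟩ | rfl <;> simp

/-- Proof plumbing (block calculus / bookkeeping). [folklore] -/
private theorem hblk_inj {α : Type*} {a a' : α} {r r' c c' : Fin p → α} {T T' : Matrix (Fin p) (Fin p) α} :
    hblk a r c T = hblk a' r' c' T' ↔ a = a' ∧ r = r' ∧ c = c' ∧ T = T' := by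
  constructor
  · intro h
    have h' := fun i j => congrFun (congrFun h i) j
    exact ⟨by simpa using h' 0 0, funext fun j => by simpa using h' 0 j.succ,
      funext fun i => by simpa using h' i.succ 0, Matrix.ext fun i j => by simpa using h' i.succ j.succ⟩
  · rintro ⟨rfl, rfl, rfl, rfl⟩; rfl

/-- Proof plumbing (block calculus / bookkeeping). [folklore] -/
private theorem lblk_inj {α : Type*} {T T' : Matrix (Fin p) (Fin p) α} {d d' s s' : Fin p → α} {z z' : α} :
    lblk T d s z = lblk T' d' s' z' ↔ T = T' ∧ d = d' ∧ s = s' ∧ z = z' := by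
  constructor
  · intro h
    have h' := fun i j => congrFun (congrFun h i) j
    exact ⟨Matrix.ext fun i j => by simpa using h' i.castSucc j.castSucc,
      funext fun i => by simpa using h' i.castSucc (Fin.last p),
      funext fun j => by simpa using h' (Fin.last p) j.castSucc, by simpa using h' (Fin.last p) (Fin.last p)⟩
  · rintro ⟨rfl, rfl, rfl, rfl⟩; rfl

/-- Proof plumbing (block calculus / bookkeeping). [folklore] -/
private theorem hblk_mem_nt {a : K} {r c : Fin p → K} {T : Matrix (Fin p) (Fin p) K} :
    hblk a r c T ∈ nt K (p + 1) ↔ a = 0 ∧ c = 0 ∧ T ∈ nt K p := by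
  constructor
  · intro h
    exact ⟨by simpa using h 0 0 le_rfl, funext fun i => by simpa using h i.succ 0 (Fin.zero_le _),
      fun i j hij => by simpa using h i.succ j.succ (Fin.succ_le_succ_iff.2 hij)⟩
  · rintro ⟨rfl, rfl, hT⟩ i j hij
    rcases Fin.eq_zero_or_eq_succ i with rfl | ⟨i, rfl⟩ <;>
      rcases Fin.eq_zero_or_eq_succ j with rfl | ⟨j, rfl⟩
    · simp
    · exact absurd hij (not_le.2 (Fin.succ_pos j))
    · simp
    · simpa using hT i j (Fin.succ_le_succ_iff.1 hij)

/-- Proof plumbing (block calculus / bookkeeping). [folklore] -/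
private theorem lblk_mem_nt {T : Matrix (Fin p) (Fin p) K} {d s : Fin p → K} {z : K} :
    lblk T d s z ∈ nt K (p + 1) ↔ T ∈ nt K p ∧ s = 0 ∧ z = 0 := by
  constructor
  · intro h
    exact ⟨fun i j hij => by simpa using h i.castSucc j.castSucc (Fin.castSucc_le_castSucc_iff.2 hij),
      funext fun j => by simpa using h (Fin.last p) j.castSucc (Fin.castSucc_lt_last j).le,
      by simpa using h (Fin.last p) (Fin.last p) le_rfl⟩
  · rintro ⟨hT, rfl, rfl⟩ i j hij
    rcases Fin.eq_castSucc_or_eq_last i with ⟨i, rfl⟩ | rfl <;>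
      rcases Fin.eq_castSucc_or_eq_last j with ⟨j, rfl⟩ | rfl
    · simpa using hT i j (Fin.castSucc_le_castSucc_iff.1 hij)
    · exact absurd hij (not_le.2 (Fin.castSucc_lt_last i))
    · simp
    · simp

/-- Block multiplication for the last split. [folklore] -/
private theorem lblk_mul_lblk (T T' : Matrix (Fin p) (Fin p) K) (d d' s s' : Fin p → K) (z z' : K) :
    lblk T d s z * lblk T' d' s' z' =
      lblk (T * T' + vecMulVec d s') (T *ᵥ d' + z' • d) (s ᵥ* T' + z • s') (s ⬝ᵥ d' + z * z') := by
  ext i j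
  rw [Matrix.mul_apply, Fin.sum_univ_castSucc]
  rcases Fin.eq_castSucc_or_eq_last i with ⟨i, rfl⟩ | rfl <;>
    rcases Fin.eq_castSucc_or_eq_last j with ⟨j, rfl⟩ | rfl <;>
    simp [dotProduct, Matrix.vecMul, Matrix.mulVec, Matrix.mul_apply, vecMulVec_apply, mul_comm]

/-- Proof plumbing (block calculus / bookkeeping). [folklore] -/
private theorem lblk_one : lblk (1 : Matrix (Fin p) (Fin p) K) 0 0 1 = 1 := by
  ext i j
  rcases Fin.eq_castSucc_or_eq_last i with ⟨i, rfl⟩ | rfl <;>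
    rcases Fin.eq_castSucc_or_eq_last j with ⟨j, rfl⟩ | rfl
  · simp [Matrix.one_apply]
  · simp [(Fin.castSucc_lt_last i).ne]
  · simp [(Fin.castSucc_lt_last j).ne']
  · simp

/-- Proof plumbing (block calculus / bookkeeping). [folklore] -/
private theorem lblk_zero : lblk (0 : Matrix (Fin p) (Fin p) K) 0 0 0 = 0 := by
  ext i j
  rcases Fin.eq_castSucc_or_eq_last i with ⟨i, rfl⟩ | rfl <;>
    rcases Fin.eq_castSucc_or_eq_last j with ⟨j, rfl⟩ | rfl <;> simp

/-- Proof plumbing (block calculus / bookkeeping). [folklore] -/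
private theorem lblk_surj {α : Type*} (N : Matrix (Fin (p + 1)) (Fin (p + 1)) α) :
    ∃ T d s z, N = lblk T d s z :=
  ⟨_, _, _, _, lblk_eta N⟩

/-- The lower shear `Q₁ = [[I, 0], [L, 1]]` of [dSP13] Claim 1 (inverse `[[I, 0], [−L, 1]]`), as a unit.
[cite: deSeguinsPazzis2013Gerstenhaber, §4.3 Claim 1] -/
def lshear (L : Fin p → K) : (Matrix (Fin (p + 1)) (Fin (p + 1)) K)ˣ where
  val := lblk 1 0 L 1
  inv := lblk 1 0 (-L) 1
  val_inv := by rw [lblk_mul_lblk, ← lblk_one, lblk_inj]; simp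
  inv_val := by rw [lblk_mul_lblk, ← lblk_one, lblk_inj]; simp

/-- Conjugating `[[T, d], [s, z]]` by the lower shear `[[1, 0], [L, 1]]`. [folklore] -/
private theorem conjL_lshear_lblk (L : Fin p → K) (T : Matrix (Fin p) (Fin p) K) (d s : Fin p → K) (z : K) :
    conjL (lshear L) (lblk T d s z) =
      lblk (T - vecMulVec d L) d (L ᵥ* T + s - (L ⬝ᵥ d + z) • L) (L ⬝ᵥ d + z) := by
  rw [conjL_apply]
  show lblk 1 0 L 1 * lblk T d s z * lblk 1 0 (-L) 1 = _
  rw [lblk_mul_lblk, lblk_mul_lblk, lblk_inj]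
  refine ⟨?_, ?_, ?_, ?_⟩
  · simp [sub_eq_add_neg, Matrix.vecMulVec_neg]
  · simp
  · simp [sub_eq_add_neg, add_smul, smul_neg, add_assoc, add_comm]
  · simp [add_comm]

end Blocks2

/-! ## Compressions and shears on `Fin (m + 2)` -/

section Compress

variable {m : ℕ}

/-- Proof plumbing (block calculus / bookkeeping). [folklore] -/
private theorem castSucc_succ_eq_md (k : Fin m) : k.succ.castSucc = md k := rfl

/-- Proof plumbing (block calculus / bookkeeping). [folklore] -/
private theorem succ_castSucc_eq_md (k : Fin m) : k.castSucc.succ = md k := rfl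

/-- Upper-left compression `K(M)` (delete the last row and column). [cite: deSeguinsPazzis2013Gerstenhaber, §3] -/
def ulL (K : Type*) [Field K] (p : ℕ) :
    Matrix (Fin (p + 1)) (Fin (p + 1)) K →ₗ[K] Matrix (Fin p) (Fin p) K where
  toFun M := M.submatrix Fin.castSucc Fin.castSucc
  map_add' _ _ := rfl
  map_smul' _ _ := rfl

/-- Lower-right compression `I(M)` (delete the first row and column). [cite: deSeguinsPazzis2013Gerstenhaber, §4.3] -/
def lrL (K : Type*) [Field K] (p : ℕ) :
    Matrix (Fin (p + 1)) (Fin (p + 1)) K →ₗ[K] Matrix (Fin p) (Fin p) K where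
  toFun M := M.submatrix Fin.succ Fin.succ
  map_add' _ _ := rfl
  map_smul' _ _ := rfl

/-- `C(M)`: the last column above the diagonal. [cite: deSeguinsPazzis2013Gerstenhaber, §3] -/
def lastColL (K : Type*) [Field K] (p : ℕ) : Matrix (Fin (p + 1)) (Fin (p + 1)) K →ₗ[K] (Fin p → K) where
  toFun M := fun i => M i.castSucc (Fin.last p)
  map_add' _ _ := rfl
  map_smul' _ _ := rfl

/-- `R(M)`: the first row right of the diagonal. [cite: deSeguinsPazzis2013Gerstenhaber, §4.3] -/
def topRowL (K : Type*) [Field K] (p : ℕ) : Matrix (Fin (p + 1)) (Fin (p + 1)) K →ₗ[K] (Fin p → K) where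
  toFun M := fun j => M 0 j.succ
  map_add' _ _ := rfl
  map_smul' _ _ := rfl

section simp_lemmas2
variable {p : ℕ} (a : K) (r c : Fin p → K) (T : Matrix (Fin p) (Fin p) K) (d s : Fin p → K) (z : K)

/-- Proof plumbing (block calculus / bookkeeping). [folklore] -/
@[simp] private theorem ulL_lblk : ulL K p (lblk T d s z) = T := by
  ext i j; change lblk T d s z i.castSucc j.castSucc = _; simp

/-- Proof plumbing (block calculus / bookkeeping). [folklore] -/
@[simp] private theorem lastColL_lblk : lastColL K p (lblk T d s z) = d := by
  ext i; change lblk T d s z i.castSucc (Fin.last p) = _; simp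

/-- Proof plumbing (block calculus / bookkeeping). [folklore] -/
@[simp] private theorem lrL_hblk : lrL K p (hblk a r c T) = T := by
  ext i j; change hblk a r c T i.succ j.succ = _; simp

/-- Proof plumbing (block calculus / bookkeeping). [folklore] -/
@[simp] private theorem topRowL_hblk : topRowL K p (hblk a r c T) = r := by
  ext j; change hblk a r c T 0 j.succ = _; simp

end simp_lemmas2

section simp_lemmas
variable (a : K) (r : Fin m → K) (b : K) (c : Fin m → K) (T : Matrix (Fin m) (Fin m) K) (d : Fin m → K)
    (e : K) (s : Fin m → K) (z : K)

/-- Proof plumbing (block calculus / bookkeeping). [folklore] -/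
@[simp] private theorem ulL_blk : ulL K (m + 1) (blk a r b c T d e s z) = hblk a r c T := by
  ext i j
  change blk a r b c T d e s z i.castSucc j.castSucc = _
  rcases Fin.eq_zero_or_eq_succ i with rfl | ⟨i, rfl⟩ <;>
    rcases Fin.eq_zero_or_eq_succ j with rfl | ⟨j, rfl⟩ <;>
    simp [succ_castSucc_eq_md]

/-- Proof plumbing (block calculus / bookkeeping). [folklore] -/
@[simp] private theorem lrL_blk : lrL K (m + 1) (blk a r b c T d e s z) = lblk T d s z := by
  ext i j
  change blk a r b c T d e s z i.succ j.succ = _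
  rcases Fin.eq_castSucc_or_eq_last i with ⟨i, rfl⟩ | rfl <;>
    rcases Fin.eq_castSucc_or_eq_last j with ⟨j, rfl⟩ | rfl <;>
    simp [succ_castSucc_eq_md, Fin.succ_last]

/-- Proof plumbing (block calculus / bookkeeping). [folklore] -/
@[simp] private theorem lastColL_blk : lastColL K (m + 1) (blk a r b c T d e s z) = Fin.cons b d := by
  ext i
  change blk a r b c T d e s z i.castSucc (Fin.last (m + 1)) = _
  rcases Fin.eq_zero_or_eq_succ i with rfl | ⟨i, rfl⟩ <;> simp [succ_castSucc_eq_md]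

/-- Proof plumbing (block calculus / bookkeeping). [folklore] -/
@[simp] private theorem topRowL_blk : topRowL K (m + 1) (blk a r b c T d e s z) = Fin.snoc r b := by
  ext j
  change blk a r b c T d e s z 0 j.succ = _
  rcases Fin.eq_castSucc_or_eq_last j with ⟨j, rfl⟩ | rfl <;> simp [succ_castSucc_eq_md, Fin.succ_last]

end simp_lemmas

/-- Proof plumbing (block calculus / bookkeeping). [folklore] -/
private theorem cons_eq_zero_iff {b : K} {d : Fin m → K} : (Fin.cons b d : Fin (m + 1) → K) = 0 ↔ b = 0 ∧ d = 0 := by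
  constructor
  · intro h
    exact ⟨by simpa using congrFun h 0, funext fun i => by simpa using congrFun h i.succ⟩
  · rintro ⟨rfl, rfl⟩; ext i; rcases Fin.eq_zero_or_eq_succ i with rfl | ⟨i, rfl⟩ <;> simp

/-- Proof plumbing (block calculus / bookkeeping). [folklore] -/
private theorem snoc_eq_zero_iff {r : Fin m → K} {b : K} : (Fin.snoc r b : Fin (m + 1) → K) = 0 ↔ r = 0 ∧ b = 0 := by
  constructor
  · intro h
    exact ⟨funext fun i => by simpa using congrFun h i.castSucc, by simpa using congrFun h (Fin.last m)⟩
  · rintro ⟨rfl, rfl⟩; ext i; rcases Fin.eq_castSucc_or_eq_last i with ⟨i, rfl⟩ | rfl <;> simp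

/-- Proof plumbing (block calculus / bookkeeping). [folklore] -/
private theorem blk_one : blk (1 : K) (0 : Fin m → K) 0 0 1 0 0 0 1 = 1 := by
  ext i j
  rcases fin_trichotomy i with rfl | ⟨i, rfl⟩ | rfl <;>
    rcases fin_trichotomy j with rfl | ⟨j, rfl⟩ | rfl
  · simp
  · simp [(zero_lt_md j).ne]
  · simp
  · simp [(zero_lt_md i).ne']
  · simp [Matrix.one_apply, md_inj]
  · simp [md_ne_last]
  · simp
  · simp [last_ne_md]
  · simp

/-- The lower shear `[[1, 0, 0], [0, I, 0], [l₀, l, 1]]` on `Fin (m+2)`, as a unit (`P₂ = 1 ⊕ Q₁` for `l₀ = 0`,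
the last change of basis `P` of §4.4 for `l = 0`). [cite: deSeguinsPazzis2013Gerstenhaber, §4.3–§4.4] -/
def bshear (l₀ : K) (l : Fin m → K) : (Matrix (Fin (m + 2)) (Fin (m + 2)) K)ˣ where
  val := blk 1 0 0 0 1 0 l₀ l 1
  inv := blk 1 0 0 0 1 0 (-l₀) (-l) 1
  val_inv := by rw [blk_mul_blk, ← blk_one, blk_inj]; simp
  inv_val := by rw [blk_mul_blk, ← blk_one, blk_inj]; simp

/-- Conjugating a block matrix by the lower shear `bshear l₀ l`. [folklore] -/
private theorem conjL_bshear_blk (l₀ : K) (l : Fin m → K) (a : K) (r : Fin m → K) (b : K) (c : Fin m → K)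
    (T : Matrix (Fin m) (Fin m) K) (d : Fin m → K) (e : K) (s : Fin m → K) (z : K) :
    conjL (bshear l₀ l) (blk a r b c T d e s z) =
      blk (a - b * l₀) (r - b • l) b (c - l₀ • d) (T - vecMulVec d l) d
        (l₀ * a + l ⬝ᵥ c + e - (l₀ * b + l ⬝ᵥ d + z) * l₀)
        (l₀ • r + l ᵥ* T + s - (l₀ * b + l ⬝ᵥ d + z) • l)
        (l₀ * b + l ⬝ᵥ d + z) := by
  rw [conjL_apply]
  show blk 1 0 0 0 1 0 l₀ l 1 * blk a r b c T d e s z * blk 1 0 0 0 1 0 (-l₀) (-l) 1 = _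
  rw [blk_mul_blk, blk_mul_blk, blk_inj]
  refine ⟨?_, ?_, ?_, ?_, ?_, ?_, ?_, ?_, ?_⟩
  · simp [sub_eq_add_neg]
  · simp [sub_eq_add_neg, smul_neg]
  · simp
  · simp [sub_eq_add_neg]
  · simp [sub_eq_add_neg, Matrix.vecMulVec_neg]
  · simp
  · simp [sub_eq_add_neg]
  · simp [sub_eq_add_neg, smul_neg]
  · simp

end Compress

/-! ## `dim NT_n(K) = n(n−1)/2` -/

/-- `dim_K NT_n(K) = binom(n, 2)` — the sibling file's `finrank_eq_choose_two_of_forall_mem_iff`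
applied to `nt K n` (membership in `nt K n` is `IsStrictUpper` by definition). [cite: deSeguinsPazzis2013Gerstenhaber, §4.8] -/
theorem finrank_nt (n : ℕ) : Module.finrank K (nt K n) = n.choose 2 :=
  finrank_eq_choose_two_of_forall_mem_iff (nt K n) fun _ => Iff.rfl


/-! ## The normal form of [dSP13] §4.2–§4.3 and the families `A_L`, `B_C`, `E_U`, `J_a` -/

section Core

variable {m : ℕ}

/-- Proof plumbing (block calculus / bookkeeping). [folklore] -/
private theorem blk_surj {α : Type*} (A : Matrix (Fin (m + 2)) (Fin (m + 2)) α) :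
    ∃ a r b c T d e s z, A = blk a r b c T d e s z :=
  ⟨_, _, _, _, _, _, _, _, _, blk_eta A⟩

/-- Proof plumbing (block calculus / bookkeeping). [folklore] -/
private theorem cons_eq_cons_iff {α : Type*} {b b' : α} {d d' : Fin m → α} :
    (Fin.cons b d : Fin (m + 1) → α) = Fin.cons b' d' ↔ b = b' ∧ d = d' := by
  constructor
  · intro h
    exact ⟨by simpa using congrFun h 0, funext fun i => by simpa using congrFun h i.succ⟩
  · rintro ⟨rfl, rfl⟩; rfl

/-- Proof plumbing (block calculus / bookkeeping). [folklore] -/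
private theorem snoc_eq_snoc_iff {α : Type*} {r r' : Fin m → α} {b b' : α} :
    (Fin.snoc r b : Fin (m + 1) → α) = Fin.snoc r' b' ↔ r = r' ∧ b = b' := by
  constructor
  · intro h
    exact ⟨funext fun i => by simpa using congrFun h i.castSucc, by simpa using congrFun h (Fin.last m)⟩
  · rintro ⟨rfl, rfl⟩; rfl

/-- The situation of [dSP13] §4.2 after the changes of basis `P` (permutation) and `P₁ = Q ⊕ 1`:
a nilpotent linear subspace `𝒱 ⊆ Mat_{m+2}(K)` of dimension `binom(m+2, 2)` such that `e_{m+2}` is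
`𝒱`-adapted, **(A')** `K(𝒲₁) = NT_{m+1}(K)` where `𝒲₁ = {M ∈ 𝒱 : C(M) = 0}`, and **(B)** `C(𝒱) = K^{m+1}`.
(Proof bookkeeping for Theorem 1.) [cite: deSeguinsPazzis2013Gerstenhaber, §4.2 (A') (B)] -/
structure IsPreNormalized (V : Submodule K (Matrix (Fin (m + 2)) (Fin (m + 2)) K)) : Prop where
  /-- `𝒱` is a nilpotent subspace. -/
  nil : ∀ A ∈ V, IsNilpotent A
  /-- `dim 𝒱 = binom(m+2, 2)`. -/
  dim : Module.finrank K V = (m + 2).choose 2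
  /-- `e_{m+2}` is `𝒱`-adapted: no non-zero matrix of `𝒱` is supported on the last row. -/
  adapted : ∀ A ∈ V, (∀ i, i ≠ Fin.last (m + 1) → ∀ j, A i j = 0) → A = 0
  /-- (A'), inclusion `K(𝒲₁) ⊆ NT_{m+1}`. -/
  ul_mem : ∀ A ∈ V, lastColL K (m + 1) A = 0 → ulL K (m + 1) A ∈ nt K (m + 1)
  /-- (A'), inclusion `NT_{m+1} ⊆ K(𝒲₁)`. -/
  ul_surj : ∀ U ∈ nt K (m + 1), ∃ A ∈ V, lastColL K (m + 1) A = 0 ∧ ulL K (m + 1) A = U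
  /-- (B): `C(𝒱) = K^{m+1}`. -/
  col_surj : ∀ c : Fin (m + 1) → K, ∃ A ∈ V, lastColL K (m + 1) A = c

/-- The situation of [dSP13] §4.3 after the further change of basis `P₂ = 1 ⊕ Q₁` (Claim 1):
in addition **(C')** `I(𝒲₂) = NT_{m+1}(K)` where `𝒲₂ = {M ∈ 𝒱 : R(M) = 0}`. (Proof bookkeeping for
Theorem 1.) [cite: deSeguinsPazzis2013Gerstenhaber, §4.3 (C')] -/
structure IsNormalized (V : Submodule K (Matrix (Fin (m + 2)) (Fin (m + 2)) K)) : Prop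
    extends IsPreNormalized V where
  /-- (C'), inclusion `I(𝒲₂) ⊆ NT_{m+1}`. -/
  lr_mem : ∀ A ∈ V, topRowL K (m + 1) A = 0 → lrL K (m + 1) A ∈ nt K (m + 1)
  /-- (C'), inclusion `NT_{m+1} ⊆ I(𝒲₂)`. -/
  lr_surj : ∀ U ∈ nt K (m + 1), ∃ A ∈ V, topRowL K (m + 1) A = 0 ∧ lrL K (m + 1) A = U

variable {V : Submodule K (Matrix (Fin (m + 2)) (Fin (m + 2)) K)}

/-- `e_{m+2}` adapted, in block form. [cite: deSeguinsPazzis2013Gerstenhaber, §4.2] -/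
private theorem IsPreNormalized.lastRow (hV : IsPreNormalized V) {e z : K} {s : Fin m → K}
    (hA : blk 0 0 0 0 0 0 e s z ∈ V) : e = 0 ∧ s = 0 ∧ z = 0 := by
  have h := hV.adapted _ hA (fun i hi j => by
    rcases fin_trichotomy i with rfl | ⟨i, rfl⟩ | rfl
    · rcases fin_trichotomy j with rfl | ⟨j, rfl⟩ | rfl <;> simp
    · rcases fin_trichotomy j with rfl | ⟨j, rfl⟩ | rfl <;> simp
    · exact absurd rfl hi)
  rw [← blk_zero, blk_inj] at h
  exact ⟨h.2.2.2.2.2.2.1, h.2.2.2.2.2.2.2.1, h.2.2.2.2.2.2.2.2⟩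

/-- `a(M) = 0` when `C(M) = 0`. [cite: deSeguinsPazzis2013Gerstenhaber, §3] -/
private theorem IsPreNormalized.corner_eq_zero (hV : IsPreNormalized V) {a e z : K} {r c s : Fin m → K}
    {T : Matrix (Fin m) (Fin m) K} (hA : blk a r 0 c T 0 e s z ∈ V) : z = 0 := by
  have h := apply_diag_eq_zero_of_col (N := blk a r 0 c T 0 e s z) (Fin.last (m + 1)) (fun j hj => by
    rcases fin_trichotomy j with rfl | ⟨j, rfl⟩ | rfl
    · simp
    · simp
    · exact absurd rfl hj) (hV.nil _ hA)
  simpa using h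

/-- `b(M) = 0` when `R(M) = 0`. [cite: deSeguinsPazzis2013Gerstenhaber, §4.3] -/
private theorem IsPreNormalized.corner_eq_zero' (hV : IsPreNormalized V) {a e z : K} {c d s : Fin m → K}
    {T : Matrix (Fin m) (Fin m) K} (hA : blk a 0 0 c T d e s z ∈ V) : a = 0 := by
  have h := apply_diag_eq_zero_of_row (N := blk a 0 0 c T d e s z) 0 (fun j hj => by
    rcases fin_trichotomy j with rfl | ⟨j, rfl⟩ | rfl
    · exact absurd rfl hj
    · simp
    · simp) (hV.nil _ hA)
  simpa using h

/-- `e_1` is `𝒱ᵀ`-adapted: no non-zero matrix of `𝒱` is supported on the first column.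
[cite: deSeguinsPazzis2013Gerstenhaber, §4.3] -/
private theorem IsPreNormalized.firstCol (hV : IsPreNormalized V) {a e : K} {c : Fin m → K}
    (hA : blk a 0 0 c 0 0 e 0 0 ∈ V) : a = 0 ∧ c = 0 ∧ e = 0 := by
  have hK := hV.ul_mem _ hA (by simp [cons_eq_zero_iff])
  rw [ulL_blk, hblk_mem_nt] at hK
  obtain ⟨rfl, rfl, -⟩ := hK
  exact ⟨rfl, rfl, (hV.lastRow hA).1⟩

/-- **(D)**: for every row `L` the space contains `A_L = [[0, L, 0], [0, 0, 0], [f(L), φ(L), 0]]`.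
[cite: deSeguinsPazzis2013Gerstenhaber, §4.3 (D)] -/
private theorem IsPreNormalized.exists_A (hV : IsPreNormalized V) (L : Fin m → K) :
    ∃ (f : K) (φ : Fin m → K), blk 0 L 0 0 0 0 f φ 0 ∈ V := by
  obtain ⟨A, hAV, hC, hK⟩ := hV.ul_surj (hblk 0 L 0 0) (hblk_mem_nt.2 ⟨rfl, rfl, Submodule.zero_mem _⟩)
  obtain ⟨a, r, b, c, T, d, e, s, z, rfl⟩ := blk_surj A
  rw [lastColL_blk, cons_eq_zero_iff] at hC
  obtain ⟨rfl, rfl⟩ := hC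
  rw [ulL_blk, hblk_inj] at hK
  obtain ⟨rfl, rfl, rfl, rfl⟩ := hK
  obtain rfl := hV.corner_eq_zero hAV
  exact ⟨e, s, hAV⟩

/-- Uniqueness of `A_L`. [cite: deSeguinsPazzis2013Gerstenhaber, §4.3] -/
private theorem IsPreNormalized.unique_A (hV : IsPreNormalized V) {L : Fin m → K} {f f' : K}
    {φ φ' : Fin m → K} (h : blk 0 L 0 0 0 0 f φ 0 ∈ V) (h' : blk 0 L 0 0 0 0 f' φ' 0 ∈ V) :
    f = f' ∧ φ = φ' := by
  have hd := V.sub_mem h h'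
  rw [blk_sub] at hd
  simp only [sub_self] at hd
  have := hV.lastRow hd
  exact ⟨sub_eq_zero.1 this.1, sub_eq_zero.1 this.2.1⟩

/-- Uniqueness of `B_C`. [cite: deSeguinsPazzis2013Gerstenhaber, §4.3] -/
private theorem IsPreNormalized.unique_B (hV : IsPreNormalized V) {C : Fin m → K} {g g' : K}
    {ψ ψ' : Fin m → K} (h : blk 0 0 0 ψ 0 C g 0 0 ∈ V) (h' : blk 0 0 0 ψ' 0 C g' 0 0 ∈ V) :
    ψ = ψ' ∧ g = g' := by
  have hd := V.sub_mem h h'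
  rw [blk_sub] at hd
  simp only [sub_self] at hd
  have := hV.firstCol hd
  exact ⟨sub_eq_zero.1 this.2.1, sub_eq_zero.1 this.2.2⟩

/-- **(E)**: for every `U ∈ NT_m(K)` the space contains `E_U = [[0, 0, 0], [0, U, 0], [h(U), 0, 0]]`.
[cite: deSeguinsPazzis2013Gerstenhaber, §4.3 (E)] -/
private theorem IsNormalized.exists_E (hV : IsNormalized V) (U : Matrix (Fin m) (Fin m) K) (hU : U ∈ nt K m) :
    ∃ h : K, blk 0 0 0 0 U 0 h 0 0 ∈ V := by
  obtain ⟨A, hAV, hC, hK⟩ := hV.ul_surj (hblk 0 0 0 U) (hblk_mem_nt.2 ⟨rfl, rfl, hU⟩)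
  obtain ⟨a, r, b, c, T, d, e, s, z, rfl⟩ := blk_surj A
  rw [lastColL_blk, cons_eq_zero_iff] at hC
  obtain ⟨rfl, rfl⟩ := hC
  rw [ulL_blk, hblk_inj] at hK
  obtain ⟨rfl, rfl, rfl, rfl⟩ := hK
  obtain rfl := hV.corner_eq_zero hAV
  have hI := hV.lr_mem _ hAV (by simp [snoc_eq_zero_iff])
  rw [lrL_blk, lblk_mem_nt] at hI
  obtain ⟨-, rfl, -⟩ := hI
  exact ⟨e, hAV⟩

/-- Uniqueness of `E_U`. [cite: deSeguinsPazzis2013Gerstenhaber, §4.3] -/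
private theorem IsPreNormalized.unique_E (hV : IsPreNormalized V) {U : Matrix (Fin m) (Fin m) K} {h h' : K}
    (hE : blk 0 0 0 0 U 0 h 0 0 ∈ V) (hE' : blk 0 0 0 0 U 0 h' 0 0 ∈ V) : h = h' := by
  have hd := V.sub_mem hE hE'
  rw [blk_sub] at hd
  simp only [sub_self] at hd
  exact sub_eq_zero.1 (hV.lastRow hd).1

/-- **(F)**: for every column `C` the space contains `B_C = [[0, 0, 0], [ψ(C), 0, C], [g(C), 0, 0]]`.
[cite: deSeguinsPazzis2013Gerstenhaber, §4.3 (F)] -/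
private theorem IsNormalized.exists_B (hV : IsNormalized V) (C : Fin m → K) :
    ∃ (ψ : Fin m → K) (g : K), blk 0 0 0 ψ 0 C g 0 0 ∈ V := by
  obtain ⟨A, hAV, hC⟩ := hV.col_surj (Fin.cons 0 C)
  obtain ⟨a, r, b, c, T, d, e, s, z, rfl⟩ := blk_surj A
  rw [lastColL_blk, cons_eq_cons_iff] at hC
  obtain ⟨rfl, rfl⟩ := hC
  obtain ⟨f, φ, hA⟩ := hV.exists_A r
  have h1 := V.sub_mem hAV hA
  rw [blk_sub] at h1
  simp only [sub_self, sub_zero] at h1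
  obtain rfl := hV.corner_eq_zero' h1
  have hI := hV.lr_mem _ h1 (by simp [snoc_eq_zero_iff])
  rw [lrL_blk, lblk_mem_nt] at hI
  obtain ⟨hT, hs, rfl⟩ := hI
  obtain ⟨hh, hE⟩ := hV.exists_E T hT
  have h2 := V.sub_mem h1 hE
  rw [blk_sub] at h2
  simp only [sub_self, sub_zero, hs] at h2
  exact ⟨c, _, h2⟩

/-- **Claim 2** (raw form): if `LC = 0` then `φ(L) C = 0` and `L ψ(C) = 0` (from `(A_L + B_C)²` nilpotent).
[cite: deSeguinsPazzis2013Gerstenhaber, §4.4 Claim 2] -/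
private theorem IsPreNormalized.claim2 (hV : IsPreNormalized V) {L C φ ψ : Fin m → K} {f g : K}
    (hA : blk 0 L 0 0 0 0 f φ 0 ∈ V) (hB : blk 0 0 0 ψ 0 C g 0 0 ∈ V) (hLC : L ⬝ᵥ C = 0) :
    φ ⬝ᵥ C = 0 ∧ L ⬝ᵥ ψ = 0 := by
  have hM : blk 0 L 0 ψ 0 C (f + g) φ 0 ∈ V := by
    have := V.add_mem hA hB; rw [blk_add] at this; simpa using this
  have hM2 : IsNilpotent (blk 0 L 0 ψ 0 C (f + g) φ 0 * blk 0 L 0 ψ 0 C (f + g) φ 0) := by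
    rw [← pow_two]; exact (hV.nil _ hM).pow_succ 1
  constructor
  · have h := apply_diag_eq_zero_of_col (Fin.last (m + 1)) (fun j hj => by
      rcases fin_trichotomy j with rfl | ⟨j, rfl⟩ | rfl
      · simp [blk_mul_blk, hLC]
      · simp [blk_mul_blk]
      · exact absurd rfl hj) hM2
    simpa [blk_mul_blk] using h
  · have h := apply_diag_eq_zero_of_row 0 (fun j hj => by
      rcases fin_trichotomy j with rfl | ⟨j, rfl⟩ | rfl
      · exact absurd rfl hj
      · simp [blk_mul_blk]
      · simp [blk_mul_blk, hLC]) hM2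
    simpa [blk_mul_blk] using h

/-- **Remark 2** (trace form): `φ(L) C + L ψ(C) = tr(A_L B_C) = 0`. [cite: deSeguinsPazzis2013Gerstenhaber, §4.4 Remark 2] -/
private theorem IsPreNormalized.remark2 (hV : IsPreNormalized V) {L C φ ψ : Fin m → K}
    {f g : K} (hA : blk 0 L 0 0 0 0 f φ 0 ∈ V) (hB : blk 0 0 0 ψ 0 C g 0 0 ∈ V) :
    L ⬝ᵥ ψ + φ ⬝ᵥ C = 0 := by
  have h := trace_mul_eq_zero_of_mem V hV.nil hA hB
  rw [blk_mul_blk, trace_blk] at h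
  simpa using h

/-! ### After the last change of basis: `φ = 0`, `ψ = 0` ([dSP13] §4.5–§4.8) -/

/-- From `(A_L + B_C)³ e_1 = LC (f(L) + g(C)) e_1`: `LC · (f(L) + g(C)) = 0`.
[cite: deSeguinsPazzis2013Gerstenhaber, §4.5 (proof of Claim 4)] -/
private theorem IsPreNormalized.key4 (hV : IsPreNormalized V) {L C : Fin m → K} {f g : K}
    (hA : blk 0 L 0 0 0 0 f 0 0 ∈ V) (hB : blk 0 0 0 0 0 C g 0 0 ∈ V) : L ⬝ᵥ C * (f + g) = 0 := by
  have hM : blk 0 L 0 0 0 C (f + g) 0 0 ∈ V := by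
    have := V.add_mem hA hB; rw [blk_add] at this; simpa using this
  have hN : IsNilpotent (blk 0 L 0 0 0 C (f + g) 0 0 * blk 0 L 0 0 0 C (f + g) 0 0 *
      blk 0 L 0 0 0 C (f + g) 0 0) := by
    have := (hV.nil _ hM).pow_succ 2; rwa [pow_succ, pow_two] at this
  have h := apply_diag_eq_zero_of_row 0 (fun j hj => by
      rcases fin_trichotomy j with rfl | ⟨j, rfl⟩ | rfl
      · exact absurd rfl hj
      · simp [blk_mul_blk]
      · simp [blk_mul_blk]) hN
  simpa [blk_mul_blk, mul_comm] using h

/-- The determinant of a nilpotent matrix vanishes. [folklore] -/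
private theorem det_eq_zero_of_isNilpotent' {ι : Type*} [Fintype ι] [DecidableEq ι] [Nonempty ι]
    {M : Matrix ι ι K} (hM : IsNilpotent M) : M.det = 0 := by
  obtain ⟨k, hk⟩ := hM
  have h := congrArg Matrix.det hk
  rw [Matrix.det_pow, Matrix.det_zero] at h
  exact IsNilpotent.eq_zero ⟨k, h⟩

/-- A block matrix with one middle index, as an explicit `3 × 3` matrix. [folklore] -/
private theorem blk_fin_one {α : Type*} (a b e z : α) (r c d s : Fin 1 → α) (T : Matrix (Fin 1) (Fin 1) α) :
    (blk a r b c T d e s z : Matrix (Fin 3) (Fin 3) α) = !![a, r 0, b; c 0, T 0 0, d 0; e, s 0, z] := by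
  ext i j
  fin_cases i <;> fin_cases j <;> rfl

/-- The determinant of a block matrix with one middle index. [folklore] -/
private theorem det_blk_fin_one (a b e z : K) (r c d s : Fin 1 → K) (T : Matrix (Fin 1) (Fin 1) K) :
    Matrix.det (blk a r b c T d e s z) =
      a * T 0 0 * z - a * d 0 * s 0 - r 0 * c 0 * z + r 0 * d 0 * e + b * c 0 * s 0 - b * T 0 0 * e := by
  rw [blk_fin_one, Matrix.det_fin_three]
  simp

/-- **Claim 4**, first half: `f = 0`, AS PRINTED: for `n ≥ 4` choose `C ≠ 0` with `LC = 0` and `L₁`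
with `L₁C = 1`; for `n = 3` and `#K > 2` use `y ∉ {0, −1}`; for `n = 3` and `#K = 2` the matrices
`A`, `B`, `J` with `tr(AJ) = tr(BJ) = tr J = 0` and `det(J + xA + yB) = 0` (`(x,y) = (0,0), (1,0), (0,1)`)
are contradictory. [cite: deSeguinsPazzis2013Gerstenhaber, §4.5 Claim 4] -/
private theorem IsNormalized.f_zero (hV : IsNormalized V)
    (hφ : ∀ (L : Fin m → K) (f : K) (φ : Fin m → K), blk 0 L 0 0 0 0 f φ 0 ∈ V → φ = 0)
    (hψ : ∀ (C ψ : Fin m → K) (g : K), blk 0 0 0 ψ 0 C g 0 0 ∈ V → ψ = 0)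
    {L : Fin m → K} {f : K} (hA : blk 0 L 0 0 0 0 f 0 0 ∈ V) : f = 0 := by
  have hAex : ∀ L' : Fin m → K, ∃ f' : K, blk 0 L' 0 0 0 0 f' 0 0 ∈ V := fun L' => by
    obtain ⟨f', φ, hA'⟩ := hV.exists_A L'
    obtain rfl := hφ _ _ _ hA'
    exact ⟨f', hA'⟩
  have hBex : ∀ C : Fin m → K, ∃ g : K, blk 0 0 0 0 0 C g 0 0 ∈ V := fun C => by
    obtain ⟨ψ, g, hB⟩ := hV.exists_B C
    obtain rfl := hψ _ _ _ hB
    exact ⟨g, hB⟩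
  by_cases hL : L = 0
  · subst hL; exact (hV.lastRow hA).1
  obtain ⟨k, hk⟩ := Function.ne_iff.1 hL
  simp only [Pi.zero_apply] at hk
  by_cases hm : ∃ k' : Fin m, k' ≠ k
  · -- `n ≥ 4`
    obtain ⟨k', hk'⟩ := hm
    obtain ⟨g, hB⟩ := hBex (L k • Pi.single k' 1 - L k' • Pi.single k 1)
    obtain ⟨f₁, hA₁⟩ := hAex ((L k)⁻¹ • Pi.single k' 1)
    have hLC : L ⬝ᵥ (L k • Pi.single k' 1 - L k' • Pi.single k 1) = 0 := by
      simp [dotProduct_sub, dotProduct_smul, mul_comm]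
    have hL₁C : ((L k)⁻¹ • Pi.single k' 1 : Fin m → K) ⬝ᵥ (L k • Pi.single k' 1 - L k' • Pi.single k 1) = 1 := by
      simp [dotProduct_sub, dotProduct_smul, hk', hk]
    have e1 := hV.key4 hA₁ hB
    rw [hL₁C, one_mul] at e1
    have hsum : blk 0 (L + (L k)⁻¹ • Pi.single k' 1) 0 0 0 0 (f + f₁) 0 0 ∈ V := by
      have := V.add_mem hA hA₁; rw [blk_add] at this; simpa using this
    have e2 := hV.key4 hsum hB
    rw [add_dotProduct, hLC, hL₁C, zero_add, one_mul] at e2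
    linear_combination e2 - e1
  · -- `n = 3`
    push Not at hm
    have hm1 : m = 1 := by
      rcases Nat.lt_or_ge m 2 with h | h
      · have := k.pos; omega
      · exfalso
        have h0 := hm ⟨0, by omega⟩
        have h1 := hm ⟨1, by omega⟩
        have h01 := congrArg Fin.val (h0.trans h1.symm)
        simp at h01
    subst hm1
    obtain rfl : k = 0 := Subsingleton.elim _ _
    have hvec : ∀ v : Fin 1 → K, v = v 0 • Pi.single 0 1 := fun v => by
      funext i; obtain rfl : i = 0 := Subsingleton.elim _ _; simp
    obtain ⟨f₁, hA₁⟩ := hAex (Pi.single 0 1)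
    obtain ⟨g₁, hB₁⟩ := hBex (Pi.single 0 1)
    have hAt : ∀ t : K, blk 0 (t • Pi.single 0 1) 0 0 0 0 (t * f₁) 0 0 ∈ V := fun t => by
      have := V.smul_mem t hA₁; rw [blk_smul] at this; simpa using this
    have key : ∀ t : K, t * (t * f₁ + g₁) = 0 := fun t => by
      have := hV.key4 (hAt t) hB₁
      simpa [smul_dotProduct] using this
    have hf : f = L 0 * f₁ := by
      have hA' := hA
      rw [hvec L] at hA'
      exact (hV.unique_A hA' (hAt (L 0))).1
    suffices hf₁ : f₁ = 0 by rw [hf, hf₁, mul_zero]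
    have k1 : f₁ + g₁ = 0 := by simpa using key 1
    by_cases hK : ∃ y : K, y ≠ 0 ∧ y ≠ -1
    · -- `#K > 2`
      obtain ⟨y, hy0, hy1⟩ := hK
      have h1y : (1 + y : K) ≠ 0 := fun h => hy1 (by linear_combination h)
      have a1 : y * f₁ + g₁ = 0 := (mul_eq_zero.1 (key y)).resolve_left hy0
      have a2 : (1 + y) * f₁ + g₁ = 0 := (mul_eq_zero.1 (key (1 + y))).resolve_left h1y
      linear_combination a2 - a1
    · -- `#K = 2`
      push Not at hK
      have h2 : (2 : K) = 0 := by have := hK 1 one_ne_zero; linear_combination this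
      by_contra hf₁
      obtain rfl : f₁ = -1 := hK f₁ hf₁
      have hg₁ : g₁ = 1 := by linear_combination k1
      subst hg₁
      obtain ⟨M, hMV, hC⟩ := hV.col_surj (Fin.cons 1 0)
      obtain ⟨a, r, b, c, T, d, e, s, z, rfl⟩ := blk_surj M
      rw [lastColL_blk, cons_eq_cons_iff] at hC
      obtain ⟨rfl, rfl⟩ := hC
      obtain ⟨fr, hAr⟩ := hAex r
      have hJ : blk a 0 1 c T 0 (e - fr) s z ∈ V := by
        have := V.sub_mem hMV hAr; rw [blk_sub] at this; simpa using this
      have hc : c 0 = 1 := by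
        have ht := trace_mul_eq_zero_of_mem V hV.nil hA₁ hJ
        rw [blk_mul_blk, trace_blk] at ht
        simp at ht
        linear_combination ht
      have hs : s 0 = -1 := by
        have ht := trace_mul_eq_zero_of_mem V hV.nil hB₁ hJ
        rw [blk_mul_blk, trace_blk] at ht
        simp at ht
        linear_combination ht
      have htr : a + T 0 0 + z = 0 := by
        have ht := (Matrix.isNilpotent_trace_of_isNilpotent (hV.nil _ hJ)).eq_zero
        rw [trace_blk, Matrix.trace_fin_one] at ht
        exact ht
      have hJA : blk a (Pi.single 0 1) 1 c T 0 (e - fr + -1) s z ∈ V := by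
        have := V.add_mem hJ hA₁; rw [blk_add] at this; simpa using this
      have hJB : blk a 0 1 c T (Pi.single 0 1) (e - fr + 1) s z ∈ V := by
        have := V.add_mem hJ hB₁; rw [blk_add] at this; simpa using this
      have hd00 := det_eq_zero_of_isNilpotent' (hV.nil _ hJ)
      have hd10 := det_eq_zero_of_isNilpotent' (hV.nil _ hJA)
      have hd01 := det_eq_zero_of_isNilpotent' (hV.nil _ hJB)
      rw [det_blk_fin_one] at hd00 hd10 hd01
      simp only [Pi.zero_apply, Pi.single_eq_same, hc, hs] at hd00 hd10 hd01
      have hz : z = T 0 0 := by linear_combination hd00 - hd10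
      have ha : a = T 0 0 := by linear_combination hd01 - hd00
      have ht0 : T 0 0 = 0 := by linear_combination htr - ha - hz - (T 0 0) * h2
      exact one_ne_zero (by linear_combination -hd00 + (a * z - (e - fr)) * ht0)

/-- The matrices `A_L = [[0, L, 0], [0, 0, 0], [0, 0, 0]]` lie in `𝒱`. [cite: deSeguinsPazzis2013Gerstenhaber, §4.7.1] -/
private theorem IsNormalized.memA (hV : IsNormalized V)
    (hφ : ∀ (L : Fin m → K) (f : K) (φ : Fin m → K), blk 0 L 0 0 0 0 f φ 0 ∈ V → φ = 0)
    (hψ : ∀ (C ψ : Fin m → K) (g : K), blk 0 0 0 ψ 0 C g 0 0 ∈ V → ψ = 0)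
    (L : Fin m → K) : blk 0 L 0 0 0 0 0 0 0 ∈ V := by
  obtain ⟨f, φ, hA⟩ := hV.exists_A L
  obtain rfl := hφ _ _ _ hA
  obtain rfl := hV.f_zero hφ hψ hA
  exact hA

/-- **Claim 4**, second half: `g = 0`; the matrices `B_C = [[0, 0, 0], [0, 0, C], [0, 0, 0]]` lie in `𝒱`.
[cite: deSeguinsPazzis2013Gerstenhaber, §4.5 Claim 4] -/
private theorem IsNormalized.memB (hV : IsNormalized V)
    (hφ : ∀ (L : Fin m → K) (f : K) (φ : Fin m → K), blk 0 L 0 0 0 0 f φ 0 ∈ V → φ = 0)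
    (hψ : ∀ (C ψ : Fin m → K) (g : K), blk 0 0 0 ψ 0 C g 0 0 ∈ V → ψ = 0)
    (C : Fin m → K) : blk 0 0 0 0 0 C 0 0 0 ∈ V := by
  obtain ⟨ψ, g, hB⟩ := hV.exists_B C
  obtain rfl := hψ _ _ _ hB
  suffices hg : g = 0 by rwa [hg] at hB
  by_cases hC : C = 0
  · subst hC; exact (hV.lastRow hB).1
  obtain ⟨k, hk⟩ := Function.ne_iff.1 hC
  simp only [Pi.zero_apply] at hk
  have e1 := hV.key4 (hV.memA hφ hψ (Pi.single k 1)) hB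
  simp only [single_dotProduct, one_mul, zero_add] at e1
  exact (mul_eq_zero.1 e1).resolve_left hk

/-- **Claim 5**: `h = 0`, from `(A_{L₀} + B_{C₀} + E_U)³ e_n = h(U) e_n` (valid for every `U ∈ NT`);
the matrices `E_U = [[0, 0, 0], [0, U, 0], [0, 0, 0]]` lie in `𝒱`. [cite: deSeguinsPazzis2013Gerstenhaber, §4.6 Claim 5] -/
private theorem IsNormalized.memE [NeZero m] (hV : IsNormalized V)
    (hφ : ∀ (L : Fin m → K) (f : K) (φ : Fin m → K), blk 0 L 0 0 0 0 f φ 0 ∈ V → φ = 0)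
    (hψ : ∀ (C ψ : Fin m → K) (g : K), blk 0 0 0 ψ 0 C g 0 0 ∈ V → ψ = 0)
    (U : Matrix (Fin m) (Fin m) K) (hU : U ∈ nt K m) : blk 0 0 0 0 U 0 0 0 0 ∈ V := by
  obtain ⟨hh, hE⟩ := hV.exists_E U hU
  suffices h0 : hh = 0 by rwa [h0] at hE
  have hU0 : ∀ i, U i 0 = 0 := fun i => hU i 0 (Fin.zero_le _)
  set e₀ : Fin m → K := Pi.single 0 1 with he₀
  have hM : blk 0 e₀ 0 0 U e₀ hh 0 0 ∈ V := by
    have := V.add_mem (V.add_mem (hV.memA hφ hψ e₀) (hV.memB hφ hψ e₀)) hE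
    rw [blk_add, blk_add] at this; simpa using this
  have hN : IsNilpotent (blk 0 e₀ 0 0 U e₀ hh 0 0 * blk 0 e₀ 0 0 U e₀ hh 0 0 * blk 0 e₀ 0 0 U e₀ hh 0 0) := by
    have := (hV.nil _ hM).pow_succ 2; rwa [pow_succ, pow_two] at this
  have hcol : ∀ i, (U * U) i 0 = 0 := fun i => by simp [Matrix.mul_apply, hU0]
  have h := apply_diag_eq_zero_of_col (Fin.last (m + 1)) (fun j hj => by
      rcases fin_trichotomy j with rfl | ⟨j, rfl⟩ | rfl
      · simp [blk_mul_blk, he₀, hU0]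
      · simp [blk_mul_blk, he₀, hcol]
      · exact absurd rfl hj) hN
  simpa [blk_mul_blk, he₀] using h


/-- The strictly upper-triangular part of a square matrix. [folklore] -/
private def su (T : Matrix (Fin m) (Fin m) K) : Matrix (Fin m) (Fin m) K :=
  Matrix.of fun i j => if i < j then T i j else 0

/-- Proof plumbing (block calculus / bookkeeping). [folklore] -/
private theorem su_mem_nt (T : Matrix (Fin m) (Fin m) K) : su T ∈ nt K m :=
  fun i j hij => by simp [su, not_lt.2 hij]

/-- **§4.7 (the matrix `J_1`)**: `E_{1,n} ∈ 𝒱`.  Printed route (`K = K₀`, §4.7.2): a matrix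
`J = [[α, 0, 1], [C₁, T, 0], [β, L₁, γ]] ∈ 𝒱`; `tr(J A_L) = tr(J B_C) = tr(J E_U) = 0` give `C₁ = 0`,
`L₁ = 0`, `T` diagonal (after adding an `E_U`), the `e_k` are eigenvectors so `T = 0`; then `tr J = 0`,
`J² e_n ∥ e_n` give `γ = −α`, `β = −α²`, and `(J + A_L + B_C)³ e_1 = −γ² LC e_1` gives `γ = 0`.
[cite: deSeguinsPazzis2013Gerstenhaber, §4.7.2] -/
private theorem IsNormalized.memJ [NeZero m] (hV : IsNormalized V)
    (hφ : ∀ (L : Fin m → K) (f : K) (φ : Fin m → K), blk 0 L 0 0 0 0 f φ 0 ∈ V → φ = 0)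
    (hψ : ∀ (C ψ : Fin m → K) (g : K), blk 0 0 0 ψ 0 C g 0 0 ∈ V → ψ = 0) :
    blk 0 0 1 0 0 0 0 0 0 ∈ V := by
  obtain ⟨A, hAV, hC⟩ := hV.col_surj (Fin.cons 1 0)
  obtain ⟨a, r, b, c, T, d, e, s, z, rfl⟩ := blk_surj A
  rw [lastColL_blk, cons_eq_cons_iff] at hC
  obtain ⟨rfl, rfl⟩ := hC
  have hJ0 : blk a 0 1 c T 0 e s z ∈ V := by
    have := V.sub_mem hAV (hV.memA hφ hψ r); rw [blk_sub] at this; simpa using this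
  -- `C₁ = 0` from `tr(J A_L) = 0`
  have hc : c = 0 := by
    funext k
    have ht := trace_mul_eq_zero_of_mem V hV.nil hJ0 (hV.memA hφ hψ (Pi.single k 1))
    rw [blk_mul_blk, trace_blk] at ht
    simpa using ht
  -- `L₁ = 0` from `tr(J B_C) = 0`
  have hs : s = 0 := by
    funext k
    have ht := trace_mul_eq_zero_of_mem V hV.nil hJ0 (hV.memB hφ hψ (Pi.single k 1))
    rw [blk_mul_blk, trace_blk] at ht
    simpa using ht
  subst hc
  subst hs
  -- the lower part of `T` vanishes from `tr(J E_U) = 0`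
  have hT : ∀ i j : Fin m, j < i → T i j = 0 := by
    intro i j hij
    have hmem : Matrix.single j i (1 : K) ∈ nt K m := by
      intro i' j' h'
      by_cases hh : j = i' ∧ i = j'
      · obtain ⟨rfl, rfl⟩ := hh; exact absurd h' (not_le.2 hij)
      · rw [Matrix.single, Matrix.of_apply, if_neg hh]
    have ht := trace_mul_eq_zero_of_mem V hV.nil hJ0 (hV.memE hφ hψ _ hmem)
    rw [blk_mul_blk, trace_blk] at ht
    simpa [Matrix.trace_mul_comm T, Matrix.trace_single_mul] using ht
  -- normalise the middle block to a diagonal one by adding `E_U`, `U` = strictly upper part of `T`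
  have hJ1 : blk a 0 1 0 (T - su T) 0 e 0 z ∈ V := by
    have := V.sub_mem hJ0 (hV.memE hφ hψ _ (su_mem_nt T)); rw [blk_sub] at this; simpa using this
  -- the middle block is diagonal, and its diagonal entries are eigenvalues, hence `0`
  have hD : T - su T = 0 := by
    have hoff : ∀ i k : Fin m, i ≠ k → (T - su T) i k = 0 := by
      intro i k hik
      rw [Matrix.sub_apply]
      rcases lt_or_gt_of_ne hik with h | h
      · simp [su, h]
      · simp [su, not_lt.2 h.le, hT i k h]
    ext i k
    rcases eq_or_ne i k with rfl | hik
    · have h := apply_diag_eq_zero_of_col (N := blk a 0 1 0 (T - su T) 0 e 0 z) (md i) (fun j hj => by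
        rcases fin_trichotomy j with rfl | ⟨j, rfl⟩ | rfl
        · simp
        · rw [blk_mm]; exact hoff j i (fun h => hj (h ▸ rfl))
        · simp) (hV.nil _ hJ1)
      rw [blk_mm] at h
      rw [h, Matrix.zero_apply]
    · rw [hoff i k hik, Matrix.zero_apply]
  rw [hD] at hJ1
  -- `tr J = 0`
  have hz : z = -a := by
    have ht := (Matrix.isNilpotent_trace_of_isNilpotent (hV.nil _ hJ1)).eq_zero
    rw [trace_blk] at ht
    simp only [Matrix.trace_zero, add_zero] at ht
    linear_combination ht
  subst hz
  -- `J² e_n ∥ e_n`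
  have he : e = -(a * a) := by
    have hN : IsNilpotent (blk a 0 1 0 (0 : Matrix (Fin m) (Fin m) K) 0 e 0 (-a) *
        blk a 0 1 0 (0 : Matrix (Fin m) (Fin m) K) 0 e 0 (-a)) := by
      rw [← pow_two]; exact (hV.nil _ hJ1).pow_succ 1
    have h := apply_diag_eq_zero_of_col (Fin.last (m + 1)) (fun j hj => by
      rcases fin_trichotomy j with rfl | ⟨j, rfl⟩ | rfl
      · simp [blk_mul_blk]
      · simp [blk_mul_blk]
      · exact absurd rfl hj) hN
    simp [blk_mul_blk] at h
    linear_combination h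
  subst he
  -- `(J + A_{L₀} + B_{C₀})³ e_1 = −γ² e_1`
  set e₀ : Fin m → K := Pi.single 0 1 with he₀
  have hM : blk a e₀ 1 0 0 e₀ (-(a * a)) 0 (-a) ∈ V := by
    have := V.add_mem (V.add_mem hJ1 (hV.memA hφ hψ e₀)) (hV.memB hφ hψ e₀)
    rw [blk_add, blk_add] at this; simpa using this
  have hN : IsNilpotent (blk a e₀ 1 0 (0 : Matrix (Fin m) (Fin m) K) e₀ (-(a * a)) 0 (-a) *
      blk a e₀ 1 0 (0 : Matrix (Fin m) (Fin m) K) e₀ (-(a * a)) 0 (-a) *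
      blk a e₀ 1 0 (0 : Matrix (Fin m) (Fin m) K) e₀ (-(a * a)) 0 (-a)) := by
    have := (hV.nil _ hM).pow_succ 2; rwa [pow_succ, pow_two] at this
  have h := apply_diag_eq_zero_of_col 0 (fun j hj => by
      rcases fin_trichotomy j with rfl | ⟨j, rfl⟩ | rfl
      · exact absurd rfl hj
      · simp [blk_mul_blk, he₀, -mul_eq_zero, -neg_eq_zero, -mul_eq_mul_left_iff, -mul_eq_mul_right_iff]
        try ring
      · simp [blk_mul_blk, he₀, -mul_eq_zero, -neg_eq_zero, -mul_eq_mul_left_iff, -mul_eq_mul_right_iff]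
        try ring) hN
  have h0 : (blk a e₀ 1 0 (0 : Matrix (Fin m) (Fin m) K) e₀ (-(a * a)) 0 (-a) *
      blk a e₀ 1 0 (0 : Matrix (Fin m) (Fin m) K) e₀ (-(a * a)) 0 (-a) *
      blk a e₀ 1 0 (0 : Matrix (Fin m) (Fin m) K) e₀ (-(a * a)) 0 (-a)) 0 0 = -(a * a) := by
    simp [blk_mul_blk, he₀, -mul_eq_zero, -neg_eq_zero, -mul_eq_mul_left_iff, -mul_eq_mul_right_iff]
    try ring
  rw [h0] at h
  have ha : a = 0 := mul_self_eq_zero.1 (neg_eq_zero.1 h)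
  subst ha
  simpa using hJ1

/-- **[dSP13] §4.8 (conclusion)**: once `φ = ψ = 0`, the space *is* `NT_{m+2}(K)`.
[cite: deSeguinsPazzis2013Gerstenhaber, §4.8] -/
private theorem IsNormalized.eq_nt [NeZero m] (hV : IsNormalized V)
    (hφ : ∀ (L : Fin m → K) (f : K) (φ : Fin m → K), blk 0 L 0 0 0 0 f φ 0 ∈ V → φ = 0)
    (hψ : ∀ (C ψ : Fin m → K) (g : K), blk 0 0 0 ψ 0 C g 0 0 ∈ V → ψ = 0) :
    V = nt K (m + 2) := by
  refine (Submodule.eq_of_le_of_finrank_eq (fun N hN => ?_) ?_).symm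
  · obtain ⟨a, r, b, c, T, d, e, s, z, rfl⟩ := blk_surj N
    rw [blk_mem_nt] at hN
    obtain ⟨rfl, rfl, hT, rfl, rfl, rfl⟩ := hN
    have := V.add_mem (V.add_mem (V.add_mem (hV.memA hφ hψ r) (V.smul_mem b (hV.memJ hφ hψ)))
      (hV.memE hφ hψ T hT)) (hV.memB hφ hψ d)
    rw [blk_smul, blk_add, blk_add, blk_add] at this
    simpa using this
  · rw [finrank_nt, hV.dim]

/-! ### [dSP13] §4.4: Claims 2–3 and the last change of basis -/

/-- **Claims 2–3**: there is `λ ∈ K` with `φ(L) = λL` and `ψ(C) = −λC` (via Claim 2, additivity of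
`φ` from the uniqueness of `A_L`, and Remark 2). [cite: deSeguinsPazzis2013Gerstenhaber, §4.4 Claims 2–3] -/
private theorem IsNormalized.exists_lambda [NeZero m] (hV : IsNormalized V) :
    ∃ lam : K, (∀ (L : Fin m → K) (f : K) (φ : Fin m → K), blk 0 L 0 0 0 0 f φ 0 ∈ V → φ = lam • L) ∧
      (∀ (C ψ : Fin m → K) (g : K), blk 0 0 0 ψ 0 C g 0 0 ∈ V → ψ = -(lam • C)) := by
  choose f φ hA using hV.exists_A
  choose ψ g hB using hV.exists_B
  have φ_add : ∀ L L', φ (L + L') = φ L + φ L' := fun L L' => by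
    have h := V.add_mem (hA L) (hA L')
    rw [blk_add] at h
    simp only [add_zero] at h
    exact ((hV.unique_A (hA (L + L')) h).2)
  have φ_smul : ∀ (t : K) L, φ (t • L) = t • φ L := fun t L => by
    have h := V.smul_mem t (hA L)
    rw [blk_smul] at h
    simp only [mul_zero, smul_zero] at h
    exact ((hV.unique_A (hA (t • L)) h).2)
  have c2 : ∀ L C, L ⬝ᵥ C = 0 → φ L ⬝ᵥ C = 0 := fun L C h => (hV.claim2 (hA L) (hB C) h).1
  set lam := φ (Pi.single 0 1) 0 with hlam
  -- `φ(e_i) ⬝ e_j = 0` for `i ≠ j`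
  have hoff : ∀ i j : Fin m, i ≠ j → φ (Pi.single i 1) j = 0 := fun i j hij => by
    have h := c2 (Pi.single i 1) (Pi.single j 1) (by simp [hij])
    simpa using h
  -- `φ(e_i) ⬝ e_i = λ`
  have hdiag : ∀ i : Fin m, φ (Pi.single i 1) i = lam := fun i => by
    by_cases hi : i = 0
    · subst hi; rfl
    · have hLC : (Pi.single i 1 + Pi.single 0 1 : Fin m → K) ⬝ᵥ (Pi.single i 1 - Pi.single 0 1) = 0 := by
        simp [sub_eq_add_neg, hi, Ne.symm hi]
      have h := c2 _ _ hLC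
      rw [φ_add] at h
      simp [sub_eq_add_neg, hoff i 0 hi, hoff 0 i (Ne.symm hi)] at h
      rw [hlam]
      linear_combination h
  have hφlam : ∀ L, φ L = lam • L := by
    let Φ : (Fin m → K) →ₗ[K] (Fin m → K) := { toFun := φ, map_add' := φ_add, map_smul' := φ_smul }
    have hΦ : Φ = lam • LinearMap.id := by
      apply (Pi.basisFun K (Fin m)).ext
      intro i
      rw [Pi.basisFun_apply, LinearMap.smul_apply, LinearMap.id_apply]
      funext j
      change φ (Pi.single i 1) j = (lam • (Pi.single i 1 : Fin m → K)) j
      by_cases hij : j = i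
      · subst hij; simp [hdiag]
      · simp [hoff i j (Ne.symm hij), hij]
    intro L
    have := LinearMap.congr_fun hΦ L
    simpa [Φ] using this
  refine ⟨lam, fun L f' φ' h => ?_, fun C ψ' g' h => ?_⟩
  · rw [(hV.unique_A h (hA L)).2, hφlam]
  · rw [(hV.unique_B h (hB C)).1]
    funext j
    have h' := hV.remark2 (hA (Pi.single j 1)) (hB C)
    rw [hφlam] at h'
    simp only [single_dotProduct, one_mul, smul_dotProduct, smul_eq_mul] at h'
    simp only [Pi.neg_apply, Pi.smul_apply, smul_eq_mul]
    linear_combination h'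

/-- Proof plumbing (block calculus / bookkeeping). [folklore] -/
private theorem mem_map_conjL_iff {ι : Type*} [Fintype ι] [DecidableEq ι] (P : (Matrix ι ι K)ˣ)
    {W : Submodule K (Matrix ι ι K)} {A : Matrix ι ι K} :
    A ∈ W.map (conjL P : Matrix ι ι K →ₗ[K] Matrix ι ι K) ↔ (conjL P).symm A ∈ W := by
  constructor
  · rintro ⟨B, hB, rfl⟩
    simpa using hB
  · intro h
    exact ⟨_, h, by simp⟩

/-- Proof plumbing (block calculus / bookkeeping). [folklore] -/
private theorem conjL_symm_bshear (l₀ : K) (l : Fin m → K) (A : Matrix (Fin (m + 2)) (Fin (m + 2)) K) :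
    (conjL (bshear l₀ l)).symm A = conjL (bshear (-l₀) (-l)) A := by
  rw [conjL_symm_apply, conjL_apply]
  show blk 1 0 0 0 1 0 (-l₀) (-l) 1 * A * blk 1 0 0 0 1 0 l₀ l 1 =
    blk 1 0 0 0 1 0 (-l₀) (-l) 1 * A * blk 1 0 0 0 1 0 (- -l₀) (- -l) 1
  rw [neg_neg, neg_neg]

/-- Proof plumbing (block calculus / bookkeeping). [folklore] -/
private theorem mem_map_bshear_iff (l₀ : K) (l : Fin m → K) {W : Submodule K (Matrix (Fin (m + 2)) (Fin (m + 2)) K)}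
    {A : Matrix (Fin (m + 2)) (Fin (m + 2)) K} :
    A ∈ W.map (conjL (bshear l₀ l) : Matrix (Fin (m + 2)) (Fin (m + 2)) K →ₗ[K] Matrix (Fin (m + 2)) (Fin (m + 2)) K) ↔ conjL (bshear (-l₀) (-l)) A ∈ W := by
  rw [mem_map_conjL_iff, conjL_symm_bshear]

/-- **The last change of basis of §4.4**: conjugating by `P = [[1,0,0],[0,I,0],[−λ,0,1]]` keeps (A'), (B),
(C') and kills `φ` and `ψ`. [cite: deSeguinsPazzis2013Gerstenhaber, §4.4 (after Remark 2)] -/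
private theorem IsNormalized.exists_clean [NeZero m] (hV : IsNormalized V) :
    ∃ lam : K, IsNormalized (V.map (conjL (bshear (-lam) (0 : Fin m → K)) : Matrix (Fin (m + 2)) (Fin (m + 2)) K →ₗ[K] Matrix (Fin (m + 2)) (Fin (m + 2)) K)) ∧
      (∀ (L : Fin m → K) (f : K) (φ : Fin m → K),
        blk 0 L 0 0 0 0 f φ 0 ∈ V.map (conjL (bshear (-lam) (0 : Fin m → K)) : Matrix (Fin (m + 2)) (Fin (m + 2)) K →ₗ[K] Matrix (Fin (m + 2)) (Fin (m + 2)) K) → φ = 0) ∧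
      (∀ (C ψ : Fin m → K) (g : K),
        blk 0 0 0 ψ 0 C g 0 0 ∈ V.map (conjL (bshear (-lam) (0 : Fin m → K)) : Matrix (Fin (m + 2)) (Fin (m + 2)) K →ₗ[K] Matrix (Fin (m + 2)) (Fin (m + 2)) K) → ψ = 0) := by
  obtain ⟨lam, hφ, hψ⟩ := hV.exists_lambda
  have key : ∀ {A : Matrix (Fin (m + 2)) (Fin (m + 2)) K},
      A ∈ V.map (conjL (bshear (-lam) (0 : Fin m → K)) : Matrix (Fin (m + 2)) (Fin (m + 2)) K →ₗ[K] Matrix (Fin (m + 2)) (Fin (m + 2)) K) ↔ conjL (bshear lam (0 : Fin m → K)) A ∈ V := by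
    intro A; rw [mem_map_bshear_iff, neg_neg, neg_zero]
  refine ⟨lam, ⟨⟨forall_isNilpotent_map_conjL _ hV.nil, by rw [finrank_map_conjL, hV.dim], ?_, ?_, ?_, ?_⟩, ?_, ?_⟩,
    ?_, ?_⟩
  · -- adapted
    intro A hA hrows
    obtain ⟨a, r, b, c, T, d, e, s, z, rfl⟩ := blk_surj A
    have ha : a = 0 := by simpa using hrows 0 zero_ne_last 0
    have hr : r = 0 := funext fun j => by simpa using hrows 0 zero_ne_last (md j)
    have hb : b = 0 := by simpa using hrows 0 zero_ne_last (Fin.last _)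
    have hc : c = 0 := funext fun i => by simpa using hrows (md i) (md_ne_last i) 0
    have hT : T = 0 := Matrix.ext fun i j => by simpa using hrows (md i) (md_ne_last i) (md j)
    have hd : d = 0 := funext fun i => by simpa using hrows (md i) (md_ne_last i) (Fin.last _)
    subst ha hr hb hc hT hd
    rw [key, conjL_bshear_blk] at hA
    simp at hA
    obtain ⟨h1, hs, hz⟩ := hV.lastRow hA
    subst hs hz
    have he : e = 0 := by simpa using h1
    subst he
    exact blk_zero
  · -- ul_mem
    intro A hA hC
    obtain ⟨a, r, b, c, T, d, e, s, z, rfl⟩ := blk_surj A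
    rw [lastColL_blk, cons_eq_zero_iff] at hC
    obtain ⟨rfl, rfl⟩ := hC
    rw [key, conjL_bshear_blk] at hA
    have h := hV.ul_mem _ hA (by simp [cons_eq_zero_iff])
    simpa using h
  · -- ul_surj
    intro U hU
    obtain ⟨A, hAV, hC, hK⟩ := hV.ul_surj U hU
    obtain ⟨a, r, b, c, T, d, e, s, z, rfl⟩ := blk_surj A
    rw [lastColL_blk, cons_eq_zero_iff] at hC
    obtain ⟨rfl, rfl⟩ := hC
    refine ⟨conjL (bshear (-lam) (0 : Fin m → K)) (blk a r 0 c T 0 e s z), ⟨_, hAV, rfl⟩, ?_, ?_⟩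
    · rw [conjL_bshear_blk]; simp [cons_eq_zero_iff]
    · rw [conjL_bshear_blk]; simpa using hK
  · -- col_surj
    intro c'
    obtain ⟨A, hAV, hC⟩ := hV.col_surj c'
    obtain ⟨a, r, b, c, T, d, e, s, z, rfl⟩ := blk_surj A
    refine ⟨conjL (bshear (-lam) (0 : Fin m → K)) (blk a r b c T d e s z), ⟨_, hAV, rfl⟩, ?_⟩
    rw [conjL_bshear_blk]; simpa using hC
  · -- lr_mem
    intro A hA hR
    obtain ⟨a, r, b, c, T, d, e, s, z, rfl⟩ := blk_surj A
    rw [topRowL_blk, snoc_eq_zero_iff] at hR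
    obtain ⟨rfl, rfl⟩ := hR
    rw [key, conjL_bshear_blk] at hA
    have h := hV.lr_mem _ hA (by simp [snoc_eq_zero_iff])
    simpa using h
  · -- lr_surj
    intro U hU
    obtain ⟨A, hAV, hR, hI⟩ := hV.lr_surj U hU
    obtain ⟨a, r, b, c, T, d, e, s, z, rfl⟩ := blk_surj A
    rw [topRowL_blk, snoc_eq_zero_iff] at hR
    obtain ⟨rfl, rfl⟩ := hR
    refine ⟨conjL (bshear (-lam) (0 : Fin m → K)) (blk a 0 0 c T d e s z), ⟨_, hAV, rfl⟩, ?_, ?_⟩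
    · rw [conjL_bshear_blk]; simp [snoc_eq_zero_iff]
    · rw [conjL_bshear_blk]; simpa using hI
  · -- φ' = 0
    intro L f' φ' h
    rw [key, conjL_bshear_blk] at h
    simp at h
    have h' := hφ _ _ _ h
    funext j
    simpa using congrFun h' j
  · -- ψ' = 0
    intro C ψ' g' h
    rw [key, conjL_bshear_blk] at h
    simp at h
    have h' := hψ _ _ _ h
    funext j
    simpa using congrFun h' j

/-- **[dSP13] §4.4–§4.8**: a normalized space is conjugate to `NT_{m+2}(K)`.
[cite: deSeguinsPazzis2013Gerstenhaber, §4.4–§4.8] -/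
private theorem IsNormalized.exists_map_conjL_eq_nt [NeZero m] (hV : IsNormalized V) :
    ∃ P : (Matrix (Fin (m + 2)) (Fin (m + 2)) K)ˣ, V.map (conjL P : Matrix (Fin (m + 2)) (Fin (m + 2)) K →ₗ[K] Matrix (Fin (m + 2)) (Fin (m + 2)) K) = nt K (m + 2) := by
  obtain ⟨lam, hV', hφ, hψ⟩ := hV.exists_clean
  exact ⟨_, hV'.eq_nt hφ hψ⟩

/-! ### Compression of products -/

/-- Proof plumbing (counting / compression of products). [folklore] -/
private theorem lrL_mul_of_row_zero {p : ℕ} (A B : Matrix (Fin (p + 1)) (Fin (p + 1)) K)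
    (hB : ∀ j, B 0 j = 0) : lrL K p (A * B) = lrL K p A * lrL K p B := by
  ext i j
  change (A * B) i.succ j.succ = _
  rw [Matrix.mul_apply, Fin.sum_univ_succ, hB, mul_zero, zero_add, Matrix.mul_apply]
  rfl

/-- Proof plumbing (block calculus / bookkeeping). [folklore] -/
private theorem lrL_pow_of_row_zero {p : ℕ} (A : Matrix (Fin (p + 1)) (Fin (p + 1)) K)
    (hA : ∀ j, A 0 j = 0) (k : ℕ) : lrL K p (A ^ k) = (lrL K p A) ^ k := by
  induction k with
  | zero =>
    rw [pow_zero, pow_zero]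
    ext i j
    change (1 : Matrix (Fin (p + 1)) (Fin (p + 1)) K) i.succ j.succ = _
    simp [Matrix.one_apply]
  | succ k ih => rw [pow_succ, lrL_mul_of_row_zero _ _ hA, ih, pow_succ]

/-- Proof plumbing (block calculus / bookkeeping). [folklore] -/
private theorem ulL_mul_of_lastRow_zero {p : ℕ} (A B : Matrix (Fin (p + 1)) (Fin (p + 1)) K)
    (hB : ∀ j, B (Fin.last p) j = 0) : ulL K p (A * B) = ulL K p A * ulL K p B := by
  ext i j
  change (A * B) i.castSucc j.castSucc = _
  rw [Matrix.mul_apply, Fin.sum_univ_castSucc, hB, mul_zero, add_zero, Matrix.mul_apply]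
  rfl

/-- Proof plumbing (block calculus / bookkeeping). [folklore] -/
private theorem ulL_pow_of_lastRow_zero {p : ℕ} (A : Matrix (Fin (p + 1)) (Fin (p + 1)) K)
    (hA : ∀ j, A (Fin.last p) j = 0) (k : ℕ) : ulL K p (A ^ k) = (ulL K p A) ^ k := by
  induction k with
  | zero =>
    rw [pow_zero, pow_zero]
    ext i j
    change (1 : Matrix (Fin (p + 1)) (Fin (p + 1)) K) i.castSucc j.castSucc = _
    simp [Matrix.one_apply]
  | succ k ih => rw [pow_succ, ulL_mul_of_lastRow_zero _ _ hA, ih, pow_succ]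

/-- Proof plumbing (block calculus / bookkeeping). [folklore] -/
private theorem ulL_mul_of_lastCol_zero {p : ℕ} (A B : Matrix (Fin (p + 1)) (Fin (p + 1)) K)
    (hA : ∀ i, A i (Fin.last p) = 0) : ulL K p (A * B) = ulL K p A * ulL K p B := by
  ext i j
  change (A * B) i.castSucc j.castSucc = _
  rw [Matrix.mul_apply, Fin.sum_univ_castSucc, hA, zero_mul, add_zero, Matrix.mul_apply]
  rfl

/-- Proof plumbing (block calculus / bookkeeping). [folklore] -/
private theorem ulL_pow_of_lastCol_zero {p : ℕ} (A : Matrix (Fin (p + 1)) (Fin (p + 1)) K)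
    (hA : ∀ i, A i (Fin.last p) = 0) (k : ℕ) : ulL K p (A ^ k) = (ulL K p A) ^ k := by
  induction k with
  | zero =>
    rw [pow_zero, pow_zero]
    ext i j
    change (1 : Matrix (Fin (p + 1)) (Fin (p + 1)) K) i.castSucc j.castSucc = _
    simp [Matrix.one_apply]
  | succ k ih => rw [pow_succ', ulL_mul_of_lastCol_zero _ _ hA, ih, pow_succ']

/-- Proof plumbing (block calculus / bookkeeping). [folklore] -/
private theorem snoc_vecMul_lblk {p : ℕ} (v : Fin p → K) (x : K) (T : Matrix (Fin p) (Fin p) K)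
    (d s : Fin p → K) (z : K) :
    Fin.snoc v x ᵥ* lblk T d s z = Fin.snoc (v ᵥ* T + x • s) (v ⬝ᵥ d + x * z) := by
  ext j
  rw [Matrix.vecMul, dotProduct, Fin.sum_univ_castSucc]
  rcases Fin.eq_castSucc_or_eq_last j with ⟨j, rfl⟩ | rfl <;>
    simp [Matrix.vecMul, dotProduct]

/-- `I(P₂ M P₂⁻¹) = Q₁ I(M) Q₁⁻¹` for `P₂ = 1 ⊕ Q₁`, `Q₁` the lower shear. [folklore] -/
private theorem lrL_conjL_bshear_zero (L : Fin m → K) (A : Matrix (Fin (m + 2)) (Fin (m + 2)) K) :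
    lrL K (m + 1) (conjL (bshear 0 L) A) = conjL (lshear L) (lrL K (m + 1) A) := by
  obtain ⟨a, r, b, c, T, d, e, s, z, rfl⟩ := blk_surj A
  rw [conjL_bshear_blk, lrL_blk, lrL_blk, conjL_lshear_lblk, lblk_inj]
  refine ⟨rfl, rfl, ?_, ?_⟩ <;> simp

/-! ### [dSP13] §4.3: `𝒱_lr`, property (C) and Claim 1 -/

/-- The lower-right space `𝒱_lr = I(𝒲₂)`. [cite: deSeguinsPazzis2013Gerstenhaber, §4.3] -/
private def Vlr (V : Submodule K (Matrix (Fin (m + 2)) (Fin (m + 2)) K)) :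
    Submodule K (Matrix (Fin (m + 1)) (Fin (m + 1)) K) :=
  (LinearMap.ker ((topRowL K (m + 1)).comp V.subtype)).map ((lrL K (m + 1)).comp V.subtype)

/-- Proof plumbing (block calculus / bookkeeping). [folklore] -/
private theorem mem_Vlr {N : Matrix (Fin (m + 1)) (Fin (m + 1)) K} :
    N ∈ Vlr V ↔ ∃ A ∈ V, topRowL K (m + 1) A = 0 ∧ lrL K (m + 1) A = N := by
  constructor
  · rintro ⟨⟨A, hAV⟩, hA, rfl⟩
    exact ⟨A, hAV, by simpa using hA, rfl⟩
  · rintro ⟨A, hAV, hR, rfl⟩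
    exact ⟨⟨A, hAV⟩, by simpa using hR, rfl⟩

/-- Proof plumbing (block calculus / bookkeeping). [folklore] -/
private theorem IsPreNormalized.Vlr_nil (hV : IsPreNormalized V) : ∀ N ∈ Vlr V, IsNilpotent N := by
  intro N hN
  obtain ⟨A, hAV, hR, rfl⟩ := mem_Vlr.1 hN
  obtain ⟨a, r, b, c, T, d, e, s, z, rfl⟩ := blk_surj A
  rw [topRowL_blk, snoc_eq_zero_iff] at hR
  obtain ⟨rfl, rfl⟩ := hR
  obtain rfl := hV.corner_eq_zero' hAV
  obtain ⟨k, hk⟩ := hV.nil _ hAV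
  refine ⟨k, ?_⟩
  rw [← lrL_pow_of_row_zero _ (fun j => by
    rcases fin_trichotomy j with rfl | ⟨j, rfl⟩ | rfl <;> simp) k, hk, map_zero]

/-- `dim 𝒱_lr = binom(m+1, 2)` (rank theorem + the inequality statement). [cite: deSeguinsPazzis2013Gerstenhaber, §4.3] -/
private theorem IsPreNormalized.finrank_Vlr (hV : IsPreNormalized V) :
    Module.finrank K (Vlr V) = (m + 1).choose 2 := by
  obtain ⟨G, hG⟩ : ∃ G : LinearMap.ker ((topRowL K (m + 1)).comp V.subtype) →ₗ[K]
      Matrix (Fin (m + 1)) (Fin (m + 1)) K,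
      G = ((lrL K (m + 1)).comp V.subtype).comp (LinearMap.ker ((topRowL K (m + 1)).comp V.subtype)).subtype :=
    ⟨_, rfl⟩
  have hrange : LinearMap.range G = Vlr V := by
    rw [hG, LinearMap.range_comp, Submodule.range_subtype, Vlr]
  have hD : ∀ D ∈ V, topRowL K (m + 1) D = 0 → lrL K (m + 1) D = 0 → D = 0 := by
    intro D hmem hR hGx
    obtain ⟨a, r, b, c, T, d, e, s, z, rfl⟩ := blk_surj D
    rw [topRowL_blk, snoc_eq_zero_iff] at hR
    obtain ⟨rfl, rfl⟩ := hR
    rw [lrL_blk, ← lblk_zero, lblk_inj] at hGx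
    obtain ⟨rfl, rfl, rfl, rfl⟩ := hGx
    obtain ⟨rfl, rfl, rfl⟩ := hV.firstCol hmem
    exact blk_zero
  have hinj : Function.Injective G := by
    intro x y hxy
    rw [hG] at hxy
    have hxy' : lrL K (m + 1) ((x : V) : Matrix (Fin (m + 2)) (Fin (m + 2)) K) =
        lrL K (m + 1) ((y : V) : Matrix (Fin (m + 2)) (Fin (m + 2)) K) := hxy
    have hdiff : ((x : V) : Matrix (Fin (m + 2)) (Fin (m + 2)) K) - ((y : V) : Matrix _ _ K) = 0 :=
      hD _ (V.sub_mem (x : V).2 (y : V).2)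
        (by rw [map_sub, sub_eq_zero]; exact (LinearMap.mem_ker.1 x.2).trans (LinearMap.mem_ker.1 y.2).symm)
        (by rw [map_sub, hxy', sub_self])
    exact Subtype.ext (Subtype.ext (sub_eq_zero.1 hdiff))
  have h1 : Module.finrank K (Vlr V) =
      Module.finrank K (LinearMap.ker ((topRowL K (m + 1)).comp V.subtype)) := by
    rw [← hrange, LinearMap.finrank_range_of_inj hinj]
  have h2 := LinearMap.finrank_range_add_finrank_ker ((topRowL K (m + 1)).comp V.subtype)
  have h3 : Module.finrank K (LinearMap.range ((topRowL K (m + 1)).comp V.subtype)) ≤ m + 1 := by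
    calc Module.finrank K (LinearMap.range ((topRowL K (m + 1)).comp V.subtype))
        ≤ Module.finrank K (Fin (m + 1) → K) := Submodule.finrank_le _
      _ = m + 1 := by rw [Module.finrank_fintype_fun_eq_card, Fintype.card_fin]
  have h4 : Module.finrank K (Vlr V) ≤ (m + 1).choose 2 := finrank_le_choose_two (m + 1) _ hV.Vlr_nil
  have h5 : (m + 2).choose 2 = (m + 1) + (m + 1).choose 2 := by
    rw [show m + 2 = (m + 1) + 1 from rfl, show 2 = 1 + 1 from rfl, Nat.choose_succ_succ', Nat.choose_one_right]
  have h6 := hV.dim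
  omega

/-- Matrices of type (C): for every column `C` some `[[T, C], [s, z]] ∈ 𝒱_lr`. [cite: deSeguinsPazzis2013Gerstenhaber, §4.3 (type (2))] -/
private theorem IsPreNormalized.exists_typeC (hV : IsPreNormalized V) (C : Fin m → K) :
    ∃ (T : Matrix (Fin m) (Fin m) K) (s : Fin m → K) (z : K), lblk T C s z ∈ Vlr V := by
  obtain ⟨A, hAV, hC⟩ := hV.col_surj (Fin.cons 0 C)
  obtain ⟨a, r, b, c, T, d, e, s, z, rfl⟩ := blk_surj A
  rw [lastColL_blk, cons_eq_cons_iff] at hC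
  obtain ⟨rfl, rfl⟩ := hC
  obtain ⟨f, φ, hA⟩ := hV.exists_A r
  have h1 := V.sub_mem hAV hA
  rw [blk_sub] at h1
  simp only [sub_self, sub_zero] at h1
  exact ⟨T, s - φ, z, mem_Vlr.2 ⟨_, h1, by simp [snoc_eq_zero_iff], by simp⟩⟩

/-- Matrices of type (U): for every `U ∈ NT_m(K)` some `[[U, 0], [s, 0]] ∈ 𝒱_lr`. [cite: deSeguinsPazzis2013Gerstenhaber, §4.3 (type (3))] -/
private theorem IsPreNormalized.exists_typeU (hV : IsPreNormalized V) (U : Matrix (Fin m) (Fin m) K)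
    (hU : U ∈ nt K m) : ∃ s : Fin m → K, lblk U 0 s 0 ∈ Vlr V := by
  obtain ⟨A, hAV, hC, hK⟩ := hV.ul_surj (hblk 0 0 0 U) (hblk_mem_nt.2 ⟨rfl, rfl, hU⟩)
  obtain ⟨a, r, b, c, T, d, e, s, z, rfl⟩ := blk_surj A
  rw [lastColL_blk, cons_eq_zero_iff] at hC
  obtain ⟨rfl, rfl⟩ := hC
  rw [ulL_blk, hblk_inj] at hK
  obtain ⟨rfl, rfl, rfl, rfl⟩ := hK
  obtain rfl := hV.corner_eq_zero hAV
  exact ⟨s, mem_Vlr.2 ⟨_, hAV, by simp [snoc_eq_zero_iff], by simp⟩⟩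

/-- **Claim 1**: a lower shear `Q₁ = [[I, 0], [L, 1]]` with `Q₁ 𝒱_lr Q₁⁻¹ = NT_{m+1}(K)`.
[cite: deSeguinsPazzis2013Gerstenhaber, §4.3 Claim 1] -/
private theorem IsPreNormalized.claim1 (hV : IsPreNormalized V)
    (IH : ∀ W : Submodule K (Matrix (Fin (m + 1)) (Fin (m + 1)) K), (∀ A ∈ W, IsNilpotent A) →
      Module.finrank K W = (m + 1).choose 2 →
      ∃ Q : (Matrix (Fin (m + 1)) (Fin (m + 1)) K)ˣ,
        W = (nt K (m + 1)).map (conjL Q : Matrix (Fin (m + 1)) (Fin (m + 1)) K →ₗ[K] Matrix (Fin (m + 1)) (Fin (m + 1)) K)) :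
    ∃ L : Fin m → K, (Vlr V).map (conjL (lshear L) : Matrix (Fin (m + 1)) (Fin (m + 1)) K →ₗ[K]
      Matrix (Fin (m + 1)) (Fin (m + 1)) K) = nt K (m + 1) := by
  obtain ⟨Q, hQ⟩ := IH (Vlr V) hV.Vlr_nil hV.finrank_Vlr
  -- the common image hyperplane: `w N = 0` for the last row `w` of `Q⁻¹`
  set w : Fin (m + 1) → K := Pi.single (Fin.last m) 1 ᵥ* ((Q⁻¹ : (Matrix (Fin (m + 1)) (Fin (m + 1)) K)ˣ) :
    Matrix (Fin (m + 1)) (Fin (m + 1)) K) with hw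
  have hwN : ∀ N ∈ Vlr V, w ᵥ* N = 0 := by
    intro N hN
    rw [hQ] at hN
    obtain ⟨U, hU, rfl⟩ := hN
    rw [LinearEquiv.coe_coe, conjL_apply, hw, Matrix.vecMul_vecMul, ← mul_assoc, ← mul_assoc, Units.inv_mul,
      one_mul, ← Matrix.vecMul_vecMul, Matrix.single_one_vecMul]
    have : (U.row (Fin.last m)) = 0 := funext fun j => hU _ _ (Fin.le_last j)
    rw [this, Matrix.zero_vecMul]
  have hw0 : w ≠ 0 := by
    intro h
    have : w ᵥ* (Q : Matrix (Fin (m + 1)) (Fin (m + 1)) K) = Pi.single (Fin.last m) 1 := by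
      rw [hw, Matrix.vecMul_vecMul, Units.inv_mul, Matrix.vecMul_one]
    rw [h, Matrix.zero_vecMul] at this
    have h1 := congrFun this (Fin.last m)
    simp at h1
  -- `w_last ≠ 0`
  have hwl : w (Fin.last m) ≠ 0 := by
    intro hl
    obtain ⟨j, hj⟩ := Function.ne_iff.1 hw0
    rcases Fin.eq_castSucc_or_eq_last j with ⟨k, rfl⟩ | rfl
    · obtain ⟨T, s, z, hN⟩ := hV.exists_typeC (Pi.single k 1)
      have h := congrFun (hwN _ hN) (Fin.last m)
      rw [← Fin.snoc_init_self w, snoc_vecMul_lblk] at h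
      simp [Fin.init, hl] at h
      exact hj h
    · exact hj hl
  -- the shear
  set L : Fin m → K := fun i => w i.castSucc / w (Fin.last m) with hL
  have hLN : ∀ {T : Matrix (Fin m) (Fin m) K} {d s : Fin m → K} {z : K}, lblk T d s z ∈ Vlr V →
      L ᵥ* T + s = 0 ∧ L ⬝ᵥ d + z = 0 := by
    intro T d s z hN
    have h := hwN _ hN
    rw [← Fin.snoc_init_self w, snoc_vecMul_lblk, snoc_eq_zero_iff] at h
    have e1 : L = (w (Fin.last m))⁻¹ • Fin.init w := by
      funext i; simp [hL, Fin.init, div_eq_inv_mul]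
    refine ⟨?_, ?_⟩
    · have h1 := congrArg (fun v => (w (Fin.last m))⁻¹ • v) h.1
      beta_reduce at h1
      rw [smul_zero, smul_add, ← Matrix.smul_vecMul, ← e1, smul_smul, inv_mul_cancel₀ hwl, one_smul] at h1
      exact h1
    · have e2 : L ⬝ᵥ d = (w (Fin.last m))⁻¹ * (Fin.init w ⬝ᵥ d) := by rw [e1, smul_dotProduct, smul_eq_mul]
      rw [e2]
      have h2 := h.2
      field_simp
      linear_combination h2
  refine ⟨L, ?_⟩
  -- every matrix of `𝒰 = Q₁ 𝒱_lr Q₁⁻¹` has zero last row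
  have hform : ∀ N ∈ Vlr V, ∃ (T : Matrix (Fin m) (Fin m) K) (d : Fin m → K),
      conjL (lshear L) N = lblk T d 0 0 := by
    intro N hN
    obtain ⟨T, d, s, z, rfl⟩ := lblk_surj N
    obtain ⟨h1, h2⟩ := hLN hN
    refine ⟨T - vecMulVec d L, d, ?_⟩
    rw [conjL_lshear_lblk, lblk_inj]
    exact ⟨rfl, rfl, by rw [h1, h2, zero_smul, sub_zero], h2⟩
  -- `T(𝒰)` is nilpotent, contains `NT_m`, hence equals it
  set TU := ((Vlr V).map (conjL (lshear L) : Matrix (Fin (m + 1)) (Fin (m + 1)) K →ₗ[K]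
      Matrix (Fin (m + 1)) (Fin (m + 1)) K)).map (ulL K m) with hTU
  have hTnil : ∀ B ∈ TU, IsNilpotent B := by
    rintro _ ⟨_, ⟨N, hN, rfl⟩, rfl⟩
    obtain ⟨T, d, hTd⟩ := hform N hN
    have hnil : IsNilpotent (conjL (lshear L) N) := (isNilpotent_conjL_iff _ _).2 (hV.Vlr_nil N hN)
    obtain ⟨k, hk⟩ := hnil
    refine ⟨k, ?_⟩
    rw [LinearEquiv.coe_coe, ← ulL_pow_of_lastRow_zero _ (fun j => by
      rw [hTd]; rcases Fin.eq_castSucc_or_eq_last j with ⟨j, rfl⟩ | rfl <;> simp) k, hk, map_zero]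
  have hle : nt K m ≤ TU := by
    intro U hU
    obtain ⟨s, hN⟩ := hV.exists_typeU U hU
    refine ⟨conjL (lshear L) (lblk U 0 s 0), ⟨_, hN, rfl⟩, ?_⟩
    rw [conjL_lshear_lblk]; simp
  have hTeq : TU = nt K m :=
    (Submodule.eq_of_le_of_finrank_le hle (by rw [finrank_nt]; exact finrank_le_choose_two m _ hTnil)).symm
  -- hence `𝒰 ⊆ NT_{m+1}`, with equality by dimensions
  apply Submodule.eq_of_le_of_finrank_eq
  · rintro _ ⟨N, hN, rfl⟩
    obtain ⟨T, d, hTd⟩ := hform N hN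
    rw [LinearEquiv.coe_coe, hTd, lblk_mem_nt]
    refine ⟨?_, rfl, rfl⟩
    rw [← hTeq]
    exact ⟨conjL (lshear L) N, ⟨N, hN, rfl⟩, by rw [hTd]; simp⟩
  · rw [finrank_map_conjL, hV.finrank_Vlr, finrank_nt]

/-- **§4.3, after Claim 1**: conjugating a pre-normalized space by `P₂ = 1 ⊕ Q₁` gives a normalized one
((A'), (B) unchanged, (C') gained). [cite: deSeguinsPazzis2013Gerstenhaber, §4.3 (C')] -/
private theorem IsPreNormalized.exists_isNormalized (hV : IsPreNormalized V)
    (IH : ∀ W : Submodule K (Matrix (Fin (m + 1)) (Fin (m + 1)) K), (∀ A ∈ W, IsNilpotent A) →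
      Module.finrank K W = (m + 1).choose 2 →
      ∃ Q : (Matrix (Fin (m + 1)) (Fin (m + 1)) K)ˣ,
        W = (nt K (m + 1)).map (conjL Q : Matrix (Fin (m + 1)) (Fin (m + 1)) K →ₗ[K] Matrix (Fin (m + 1)) (Fin (m + 1)) K)) :
    ∃ L : Fin m → K, IsNormalized (V.map (conjL (bshear 0 L) :
      Matrix (Fin (m + 2)) (Fin (m + 2)) K →ₗ[K] Matrix (Fin (m + 2)) (Fin (m + 2)) K)) := by
  obtain ⟨L, hL⟩ := hV.claim1 IH
  refine ⟨L, ⟨⟨forall_isNilpotent_map_conjL _ hV.nil, by rw [finrank_map_conjL, hV.dim], ?_, ?_, ?_, ?_⟩, ?_, ?_⟩⟩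
  · -- adapted
    rintro _ ⟨A, hA, rfl⟩ hrows
    obtain ⟨a, r, b, c, T, d, e, s, z, rfl⟩ := blk_surj A
    rw [LinearEquiv.coe_coe, conjL_bshear_blk] at hrows ⊢
    have hb : b = 0 := by simpa using hrows 0 zero_ne_last (Fin.last _)
    have ha : a = 0 := by simpa using hrows 0 zero_ne_last 0
    have hd : d = 0 := funext fun i => by simpa using hrows (md i) (md_ne_last i) (Fin.last _)
    have hc : c = 0 := funext fun i => by simpa using hrows (md i) (md_ne_last i) 0
    subst hb ha hd hc
    have hr : r = 0 := funext fun j => by simpa using hrows 0 zero_ne_last (md j)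
    have hT : T = 0 := Matrix.ext fun i j => by simpa using hrows (md i) (md_ne_last i) (md j)
    subst hr hT
    obtain ⟨rfl, rfl, rfl⟩ := hV.lastRow hA
    simpa using blk_zero
  · -- ul_mem
    rintro _ ⟨A, hA, rfl⟩ hC
    obtain ⟨a, r, b, c, T, d, e, s, z, rfl⟩ := blk_surj A
    rw [LinearEquiv.coe_coe, conjL_bshear_blk] at hC ⊢
    rw [lastColL_blk, cons_eq_zero_iff] at hC
    obtain ⟨rfl, rfl⟩ := hC
    have h := hV.ul_mem _ hA (by simp [cons_eq_zero_iff])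
    simpa using h
  · -- ul_surj
    intro U hU
    obtain ⟨A, hAV, hC, hK⟩ := hV.ul_surj U hU
    obtain ⟨a, r, b, c, T, d, e, s, z, rfl⟩ := blk_surj A
    rw [lastColL_blk, cons_eq_zero_iff] at hC
    obtain ⟨rfl, rfl⟩ := hC
    refine ⟨conjL (bshear 0 L) (blk a r 0 c T 0 e s z), ⟨_, hAV, rfl⟩, ?_, ?_⟩
    · rw [conjL_bshear_blk]; simp [cons_eq_zero_iff]
    · rw [conjL_bshear_blk]; simpa using hK
  · -- col_surj
    intro c'
    obtain ⟨A, hAV, hC⟩ := hV.col_surj c'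
    obtain ⟨a, r, b, c, T, d, e, s, z, rfl⟩ := blk_surj A
    refine ⟨conjL (bshear 0 L) (blk a r b c T d e s z), ⟨_, hAV, rfl⟩, ?_⟩
    rw [conjL_bshear_blk]; simpa using hC
  · -- lr_mem
    rintro _ ⟨A, hA, rfl⟩ hR
    obtain ⟨a, r, b, c, T, d, e, s, z, rfl⟩ := blk_surj A
    rw [LinearEquiv.coe_coe] at hR ⊢
    have hR' : topRowL K (m + 1) (blk a r b c T d e s z) = 0 := by
      rw [conjL_bshear_blk, topRowL_blk, snoc_eq_zero_iff] at hR
      obtain ⟨h1, rfl⟩ := hR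
      simp only [zero_smul, sub_zero] at h1
      simp [snoc_eq_zero_iff, h1]
    rw [lrL_conjL_bshear_zero, ← hL]
    exact ⟨_, mem_Vlr.2 ⟨_, hA, hR', rfl⟩, rfl⟩
  · -- lr_surj
    intro U hU
    rw [← hL] at hU
    obtain ⟨N, hN, rfl⟩ := hU
    obtain ⟨A, hAV, hR, rfl⟩ := mem_Vlr.1 hN
    refine ⟨conjL (bshear 0 L) A, ⟨_, hAV, rfl⟩, ?_, ?_⟩
    · obtain ⟨a, r, b, c, T, d, e, s, z, rfl⟩ := blk_surj A
      rw [topRowL_blk, snoc_eq_zero_iff] at hR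
      obtain ⟨rfl, rfl⟩ := hR
      rw [conjL_bshear_blk]; simp [snoc_eq_zero_iff]
    · rw [lrL_conjL_bshear_zero]; rfl

/-! ### [dSP13] §4.2: the first two changes of basis -/

/-- The permutation matrix of `σ`, as a unit; conjugating by it reindexes. [folklore] -/
private def permUnit {n : ℕ} (σ : Equiv.Perm (Fin n)) : (Matrix (Fin n) (Fin n) K)ˣ where
  val := σ.toPEquiv.toMatrix
  inv := σ.symm.toPEquiv.toMatrix
  val_inv := by
    rw [← PEquiv.toMatrix_trans, ← Equiv.toPEquiv_trans, Equiv.self_trans_symm, Equiv.toPEquiv_refl,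
      PEquiv.toMatrix_refl]
  inv_val := by
    rw [← PEquiv.toMatrix_trans, ← Equiv.toPEquiv_trans, Equiv.symm_trans_self, Equiv.toPEquiv_refl,
      PEquiv.toMatrix_refl]

/-- Proof plumbing (block calculus / bookkeeping). [folklore] -/
private theorem permUnit_val {n : ℕ} (σ : Equiv.Perm (Fin n)) :
    ((permUnit (K := K) σ : (Matrix (Fin n) (Fin n) K)ˣ) : Matrix (Fin n) (Fin n) K) = σ.toPEquiv.toMatrix := rfl

/-- Proof plumbing (block calculus / bookkeeping). [folklore] -/
private theorem permUnit_inv_val {n : ℕ} (σ : Equiv.Perm (Fin n)) :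
    (((permUnit (K := K) σ)⁻¹ : (Matrix (Fin n) (Fin n) K)ˣ) : Matrix (Fin n) (Fin n) K) =
      σ.symm.toPEquiv.toMatrix := rfl

/-- Proof plumbing (block calculus / bookkeeping). [folklore] -/
private theorem conjL_permUnit_apply {n : ℕ} (σ : Equiv.Perm (Fin n)) (A : Matrix (Fin n) (Fin n) K)
    (i j : Fin n) : conjL (permUnit σ) A i j = A (σ i) (σ j) := by
  rw [conjL_apply, permUnit_val, permUnit_inv_val, PEquiv.toMatrix_toPEquiv_mul, PEquiv.mul_toMatrix_toPEquiv]
  simp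

/-- `Q ⊕ 1`, as a unit. [folklore] -/
private def ldiag {p : ℕ} (Q : (Matrix (Fin p) (Fin p) K)ˣ) : (Matrix (Fin (p + 1)) (Fin (p + 1)) K)ˣ where
  val := lblk (Q : Matrix (Fin p) (Fin p) K) 0 0 1
  inv := lblk ((Q⁻¹ : (Matrix (Fin p) (Fin p) K)ˣ) : Matrix (Fin p) (Fin p) K) 0 0 1
  val_inv := by rw [lblk_mul_lblk, ← lblk_one, lblk_inj]; simp
  inv_val := by rw [lblk_mul_lblk, ← lblk_one, lblk_inj]; simp

/-- Proof plumbing (block calculus / bookkeeping). [folklore] -/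
private theorem conjL_ldiag_lblk {p : ℕ} (Q : (Matrix (Fin p) (Fin p) K)ˣ) (T : Matrix (Fin p) (Fin p) K)
    (d s : Fin p → K) (z : K) :
    conjL (ldiag Q) (lblk T d s z) =
      lblk ((Q : Matrix (Fin p) (Fin p) K) * T * ((Q⁻¹ : (Matrix (Fin p) (Fin p) K)ˣ) : Matrix (Fin p) (Fin p) K))
        ((Q : Matrix (Fin p) (Fin p) K) *ᵥ d) (s ᵥ* ((Q⁻¹ : (Matrix (Fin p) (Fin p) K)ˣ) : Matrix (Fin p) (Fin p) K)) z := by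
  rw [conjL_apply]
  show lblk (Q : Matrix (Fin p) (Fin p) K) 0 0 1 * lblk T d s z *
    lblk ((Q⁻¹ : (Matrix (Fin p) (Fin p) K)ˣ) : Matrix (Fin p) (Fin p) K) 0 0 1 = _
  rw [lblk_mul_lblk, lblk_mul_lblk, lblk_inj]
  refine ⟨?_, ?_, ?_, ?_⟩ <;> simp

/-- Proof plumbing (block calculus / bookkeeping). [folklore] -/
private theorem conjL_inv_conjL {ι : Type*} [Fintype ι] [DecidableEq ι] (P : (Matrix ι ι K)ˣ) (A : Matrix ι ι K) :
    conjL P⁻¹ (conjL P A) = A := by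
  rw [conjL_apply, conjL_apply, inv_inv, ← mul_assoc, ← mul_assoc, Units.inv_mul, one_mul, mul_assoc,
    Units.inv_mul, mul_one]

/-- The upper-left space `𝒱_ul = K(𝒲₁)`. [cite: deSeguinsPazzis2013Gerstenhaber, §4.2] -/
private def Vul (V : Submodule K (Matrix (Fin (m + 2)) (Fin (m + 2)) K)) :
    Submodule K (Matrix (Fin (m + 1)) (Fin (m + 1)) K) :=
  (LinearMap.ker ((lastColL K (m + 1)).comp V.subtype)).map ((ulL K (m + 1)).comp V.subtype)

/-- Proof plumbing (block calculus / bookkeeping). [folklore] -/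
private theorem mem_Vul {U : Matrix (Fin (m + 1)) (Fin (m + 1)) K} :
    U ∈ Vul V ↔ ∃ A ∈ V, lastColL K (m + 1) A = 0 ∧ ulL K (m + 1) A = U := by
  constructor
  · rintro ⟨⟨A, hAV⟩, hA, rfl⟩
    exact ⟨A, hAV, by simpa using hA, rfl⟩
  · rintro ⟨A, hAV, hC, rfl⟩
    exact ⟨⟨A, hAV⟩, by simpa using hC, rfl⟩

/-- **[dSP13] §4.2**: after a permutation of the basis (`e_n` adapted, Lemma 5) and the change of basis
`P₁ = Q ⊕ 1` given by the induction hypothesis applied to `𝒱_ul = K(𝒲₁)`, a nilpotent space of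
dimension `binom(m+2, 2)` satisfies (A') and (B). [cite: deSeguinsPazzis2013Gerstenhaber, §4.2] -/
private theorem exists_isPreNormalized (hnil : ∀ A ∈ V, IsNilpotent A)
    (hdim : Module.finrank K V = (m + 2).choose 2)
    (IH : ∀ W : Submodule K (Matrix (Fin (m + 1)) (Fin (m + 1)) K), (∀ A ∈ W, IsNilpotent A) →
      Module.finrank K W = (m + 1).choose 2 →
      ∃ Q : (Matrix (Fin (m + 1)) (Fin (m + 1)) K)ˣ,
        W = (nt K (m + 1)).map (conjL Q : Matrix (Fin (m + 1)) (Fin (m + 1)) K →ₗ[K] Matrix (Fin (m + 1)) (Fin (m + 1)) K)) :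
    ∃ P : (Matrix (Fin (m + 2)) (Fin (m + 2)) K)ˣ, IsPreNormalized (V.map (conjL P :
      Matrix (Fin (m + 2)) (Fin (m + 2)) K →ₗ[K] Matrix (Fin (m + 2)) (Fin (m + 2)) K)) := by
  -- an adapted basis vector, moved to the last position
  obtain ⟨i₀, hi₀⟩ := exists_adapted (m + 1) V hnil
  obtain ⟨σ, hσ⟩ : ∃ σ : Equiv.Perm (Fin (m + 2)), σ (Fin.last (m + 1)) = i₀ :=
    ⟨Equiv.swap (Fin.last (m + 1)) i₀, Equiv.swap_apply_left _ _⟩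
  set V₁ := V.map (conjL (permUnit (K := K) σ) :
      Matrix (Fin (m + 2)) (Fin (m + 2)) K →ₗ[K] Matrix (Fin (m + 2)) (Fin (m + 2)) K) with hV₁
  have h1nil : ∀ A ∈ V₁, IsNilpotent A := forall_isNilpotent_map_conjL _ hnil
  have h1dim : Module.finrank K V₁ = (m + 2).choose 2 := by rw [hV₁, finrank_map_conjL, hdim]
  have h1ad : ∀ A ∈ V₁, (∀ i, i ≠ Fin.last (m + 1) → ∀ j, A i j = 0) → A = 0 := by
    rintro _ ⟨A, hA, rfl⟩ hrows
    have hA0 : A = 0 := hi₀ A hA (fun j hj l => by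
      have h := hrows (σ.symm j) (fun h => hj (by rw [← hσ, ← h, Equiv.apply_symm_apply])) (σ.symm l)
      rwa [LinearEquiv.coe_coe, conjL_permUnit_apply, Equiv.apply_symm_apply, Equiv.apply_symm_apply] at h)
    rw [hA0, map_zero]
  -- elements of `V₁` with `C = 0`, in block form
  have hcorner : ∀ {T : Matrix (Fin (m + 1)) (Fin (m + 1)) K} {s : Fin (m + 1) → K} {z : K},
      lblk T 0 s z ∈ V₁ → z = 0 := by
    intro T s z hA
    have h := apply_diag_eq_zero_of_col (N := lblk T 0 s z) (Fin.last (m + 1)) (fun j hj => by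
      rcases Fin.eq_castSucc_or_eq_last j with ⟨j, rfl⟩ | rfl
      · simp
      · exact absurd rfl hj) (h1nil _ hA)
    simpa using h
  have hD : ∀ D ∈ V₁, lastColL K (m + 1) D = 0 → ulL K (m + 1) D = 0 → D = 0 := by
    intro D hmem hC hK
    obtain ⟨T, d, s, z, rfl⟩ := lblk_surj D
    rw [lastColL_lblk] at hC
    rw [ulL_lblk] at hK
    subst hC hK
    obtain rfl := hcorner hmem
    exact h1ad _ hmem (fun i hi j => by
      rcases Fin.eq_castSucc_or_eq_last i with ⟨i, rfl⟩ | rfl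
      · rcases Fin.eq_castSucc_or_eq_last j with ⟨j, rfl⟩ | rfl <;> simp
      · exact absurd rfl hi)
  -- `𝒱_ul` is nilpotent of dimension `binom(m+1, 2)`, and `C` is onto
  have hulnil : ∀ U ∈ Vul V₁, IsNilpotent U := by
    intro U hU
    obtain ⟨A, hAV, hC, rfl⟩ := mem_Vul.1 hU
    obtain ⟨T, d, s, z, rfl⟩ := lblk_surj A
    rw [lastColL_lblk] at hC
    subst hC
    obtain rfl := hcorner hAV
    obtain ⟨k, hk⟩ := h1nil _ hAV
    refine ⟨k, ?_⟩
    rw [← ulL_pow_of_lastCol_zero _ (fun i => by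
      rcases Fin.eq_castSucc_or_eq_last i with ⟨i, rfl⟩ | rfl <;> simp) k, hk, map_zero]
  obtain ⟨G, hG⟩ : ∃ G : LinearMap.ker ((lastColL K (m + 1)).comp V₁.subtype) →ₗ[K]
      Matrix (Fin (m + 1)) (Fin (m + 1)) K,
      G = ((ulL K (m + 1)).comp V₁.subtype).comp (LinearMap.ker ((lastColL K (m + 1)).comp V₁.subtype)).subtype :=
    ⟨_, rfl⟩
  have hrange : LinearMap.range G = Vul V₁ := by
    rw [hG, LinearMap.range_comp, Submodule.range_subtype, Vul]
  have hinj : Function.Injective G := by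
    intro x y hxy
    rw [hG] at hxy
    have hxy' : ulL K (m + 1) ((x : V₁) : Matrix (Fin (m + 2)) (Fin (m + 2)) K) =
        ulL K (m + 1) ((y : V₁) : Matrix (Fin (m + 2)) (Fin (m + 2)) K) := hxy
    have hdiff : ((x : V₁) : Matrix (Fin (m + 2)) (Fin (m + 2)) K) - ((y : V₁) : Matrix _ _ K) = 0 :=
      hD _ (V₁.sub_mem (x : V₁).2 (y : V₁).2)
        (by rw [map_sub, sub_eq_zero]; exact (LinearMap.mem_ker.1 x.2).trans (LinearMap.mem_ker.1 y.2).symm)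
        (by rw [map_sub, hxy', sub_self])
    exact Subtype.ext (Subtype.ext (sub_eq_zero.1 hdiff))
  have h1 : Module.finrank K (Vul V₁) =
      Module.finrank K (LinearMap.ker ((lastColL K (m + 1)).comp V₁.subtype)) := by
    rw [← hrange, LinearMap.finrank_range_of_inj hinj]
  have h2 := LinearMap.finrank_range_add_finrank_ker ((lastColL K (m + 1)).comp V₁.subtype)
  have h3 : Module.finrank K (LinearMap.range ((lastColL K (m + 1)).comp V₁.subtype)) ≤ m + 1 := by
    calc Module.finrank K (LinearMap.range ((lastColL K (m + 1)).comp V₁.subtype))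
        ≤ Module.finrank K (Fin (m + 1) → K) := Submodule.finrank_le _
      _ = m + 1 := by rw [Module.finrank_fintype_fun_eq_card, Fintype.card_fin]
  have h4 : Module.finrank K (Vul V₁) ≤ (m + 1).choose 2 := finrank_le_choose_two (m + 1) _ hulnil
  have h5 : (m + 2).choose 2 = (m + 1) + (m + 1).choose 2 := by
    rw [show m + 2 = (m + 1) + 1 from rfl, show 2 = 1 + 1 from rfl, Nat.choose_succ_succ', Nat.choose_one_right]
  have huldim : Module.finrank K (Vul V₁) = (m + 1).choose 2 := by omega
  have hCtop : LinearMap.range ((lastColL K (m + 1)).comp V₁.subtype) = ⊤ := by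
    apply Submodule.eq_top_of_finrank_eq
    rw [Module.finrank_fintype_fun_eq_card, Fintype.card_fin]
    omega
  have hCsurj : ∀ c : Fin (m + 1) → K, ∃ A ∈ V₁, lastColL K (m + 1) A = c := fun c => by
    obtain ⟨⟨A, hA⟩, hAc⟩ := LinearMap.range_eq_top.1 hCtop c
    exact ⟨A, hA, hAc⟩
  -- the induction hypothesis on `𝒱_ul` and the change of basis `Q ⊕ 1`
  obtain ⟨Q', hQ'⟩ := IH (Vul V₁) hulnil huldim
  set Q := Q'⁻¹ with hQ
  refine ⟨ldiag Q * permUnit (K := K) σ, ?_⟩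
  rw [← map_conjL_map_conjL]
  refine ⟨forall_isNilpotent_map_conjL _ h1nil, by rw [finrank_map_conjL, h1dim], ?_, ?_, ?_, ?_⟩
  · -- adapted
    rintro _ ⟨A, hA, rfl⟩ hrows
    obtain ⟨T, d, s, z, rfl⟩ := lblk_surj A
    rw [LinearEquiv.coe_coe, conjL_ldiag_lblk] at hrows ⊢
    have hT : (Q : Matrix (Fin (m + 1)) (Fin (m + 1)) K) * T * ((Q⁻¹ : (Matrix _ _ K)ˣ) : Matrix _ _ K) = 0 :=
      Matrix.ext fun i j => by simpa using hrows i.castSucc (Fin.castSucc_lt_last i).ne j.castSucc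
    have hd : (Q : Matrix (Fin (m + 1)) (Fin (m + 1)) K) *ᵥ d = 0 :=
      funext fun i => by simpa using hrows i.castSucc (Fin.castSucc_lt_last i).ne (Fin.last _)
    have hT' : T = 0 := by
      have h := congrArg (conjL Q⁻¹) hT
      rw [← conjL_apply, conjL_inv_conjL, map_zero] at h
      exact h
    have hd' : d = 0 := by
      have h := congrArg (fun v => ((Q⁻¹ : (Matrix _ _ K)ˣ) : Matrix (Fin (m + 1)) (Fin (m + 1)) K) *ᵥ v) hd
      beta_reduce at h
      rwa [Matrix.mulVec_mulVec, Units.inv_mul, Matrix.one_mulVec, Matrix.mulVec_zero] at h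
    subst hT' hd'
    have hA0 := h1ad _ hA (fun i hi j => by
      rcases Fin.eq_castSucc_or_eq_last i with ⟨i, rfl⟩ | rfl
      · rcases Fin.eq_castSucc_or_eq_last j with ⟨j, rfl⟩ | rfl <;> simp
      · exact absurd rfl hi)
    obtain ⟨-, -, rfl, rfl⟩ := (lblk_inj (T := (0 : Matrix (Fin (m + 1)) (Fin (m + 1)) K)) (T' := 0)
      (d := (0 : Fin (m + 1) → K)) (d' := 0)).1 (hA0.trans lblk_zero.symm)
    simp [lblk_zero]
  · -- ul_mem
    rintro _ ⟨A, hA, rfl⟩ hC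
    obtain ⟨T, d, s, z, rfl⟩ := lblk_surj A
    rw [LinearEquiv.coe_coe, conjL_ldiag_lblk] at hC ⊢
    rw [lastColL_lblk] at hC
    have hd' : d = 0 := by
      have h := congrArg (fun v => ((Q⁻¹ : (Matrix _ _ K)ˣ) : Matrix (Fin (m + 1)) (Fin (m + 1)) K) *ᵥ v) hC
      beta_reduce at h
      rwa [Matrix.mulVec_mulVec, Units.inv_mul, Matrix.one_mulVec, Matrix.mulVec_zero] at h
    subst hd'
    have hmem : T ∈ Vul V₁ := mem_Vul.2 ⟨_, hA, by simp, by simp⟩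
    rw [hQ'] at hmem
    obtain ⟨U, hU, rfl⟩ := hmem
    rw [ulL_lblk, LinearEquiv.coe_coe, ← conjL_apply, hQ, conjL_inv_conjL]
    exact hU
  · -- ul_surj
    intro U hU
    have hmem : conjL Q' U ∈ Vul V₁ := by rw [hQ']; exact ⟨U, hU, rfl⟩
    obtain ⟨A, hAV, hC, hK⟩ := mem_Vul.1 hmem
    obtain ⟨T, d, s, z, rfl⟩ := lblk_surj A
    rw [lastColL_lblk] at hC
    rw [ulL_lblk] at hK
    subst hC hK
    refine ⟨conjL (ldiag Q) (lblk (conjL Q' U) 0 s z), ⟨_, hAV, rfl⟩, ?_, ?_⟩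
    · rw [conjL_ldiag_lblk]; simp
    · rw [conjL_ldiag_lblk, ulL_lblk, ← conjL_apply, hQ, conjL_inv_conjL]
  · -- col_surj
    intro c
    obtain ⟨A, hAV, hC⟩ := hCsurj (((Q⁻¹ : (Matrix _ _ K)ˣ) : Matrix (Fin (m + 1)) (Fin (m + 1)) K) *ᵥ c)
    obtain ⟨T, d, s, z, rfl⟩ := lblk_surj A
    rw [lastColL_lblk] at hC
    subst hC
    refine ⟨conjL (ldiag Q) (lblk T (((Q⁻¹ : (Matrix _ _ K)ˣ) : Matrix (Fin (m + 1)) (Fin (m + 1)) K) *ᵥ c) s z),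
      ⟨_, hAV, rfl⟩, ?_⟩
    rw [conjL_ldiag_lblk, lastColL_lblk, Matrix.mulVec_mulVec, Units.mul_inv, Matrix.one_mulVec]

/-! ### [dSP13] §4.1: the case `n = 2` -/

/-- **The case `n = 2`** ([dSP13] §4.1, "trivial if `K = K₀`"): a pre-normalized space of `2 × 2`
matrices is conjugate to `NT_2(K)` (by a lower shear). [cite: deSeguinsPazzis2013Gerstenhaber, §4.1] -/
private theorem IsPreNormalized.two {V : Submodule K (Matrix (Fin (0 + 2)) (Fin (0 + 2)) K)}
    (hV : IsPreNormalized V) :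
    ∃ P : (Matrix (Fin (0 + 2)) (Fin (0 + 2)) K)ˣ, V.map (conjL P :
      Matrix (Fin (0 + 2)) (Fin (0 + 2)) K →ₗ[K] Matrix (Fin (0 + 2)) (Fin (0 + 2)) K) = nt K (0 + 2) := by
  obtain ⟨A, hAV, hC⟩ := hV.col_surj (Fin.cons 1 0)
  obtain ⟨a, r, b, c, T, d, e, s, z, rfl⟩ := blk_surj A
  rw [lastColL_blk, cons_eq_cons_iff] at hC
  obtain ⟨rfl, -⟩ := hC
  -- `tr = 0` and `A² e_2 ∥ e_2`
  have hz : z = -a := by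
    have ht := (Matrix.isNilpotent_trace_of_isNilpotent (hV.nil _ hAV)).eq_zero
    rw [trace_blk] at ht
    have hT : Matrix.trace T = 0 := by simp [Matrix.trace]
    rw [hT, add_zero] at ht
    linear_combination ht
  subst hz
  have he : e = -(a * a) := by
    have hN : IsNilpotent (blk a r 1 c T d e s (-a) * blk a r 1 c T d e s (-a)) := by
      rw [← pow_two]; exact (hV.nil _ hAV).pow_succ 1
    have h := apply_diag_eq_zero_of_col (Fin.last (0 + 1)) (fun j hj => by
      rcases fin_trichotomy j with rfl | ⟨j, rfl⟩ | rfl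
      · rw [blk_mul_blk, blk_zl]; simp
      · exact j.elim0
      · exact absurd rfl hj) hN
    rw [blk_mul_blk, blk_ll] at h
    simp only [mul_one, dotProduct, Finset.univ_eq_empty, Finset.sum_empty, add_zero, mul_neg, neg_mul,
      neg_neg] at h
    linear_combination h
  subst he
  refine ⟨bshear a 0, ?_⟩
  have hJ : blk 0 r 1 c T d 0 s 0 ∈ V.map (conjL (bshear a (0 : Fin 0 → K)) :
      Matrix (Fin (0 + 2)) (Fin (0 + 2)) K →ₗ[K] Matrix (Fin (0 + 2)) (Fin (0 + 2)) K) := by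
    refine ⟨_, hAV, ?_⟩
    rw [LinearEquiv.coe_coe, conjL_bshear_blk, blk_inj]
    refine ⟨by ring, Subsingleton.elim _ _, rfl, Subsingleton.elim _ _, Subsingleton.elim _ _,
      Subsingleton.elim _ _, ?_, Subsingleton.elim _ _, ?_⟩
    · simp only [dotProduct, Finset.univ_eq_empty, Finset.sum_empty]; ring
    · simp only [dotProduct, Finset.univ_eq_empty, Finset.sum_empty]; ring
  symm
  refine Submodule.eq_of_le_of_finrank_eq (fun N hN => ?_) ?_
  · obtain ⟨a', r', b', c', T', d', e', s', z', rfl⟩ := blk_surj N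
    rw [blk_mem_nt] at hN
    obtain ⟨rfl, rfl, -, rfl, rfl, rfl⟩ := hN
    have h := Submodule.smul_mem _ b' hJ
    rw [blk_smul] at h
    convert h using 2 <;> first | exact Subsingleton.elim _ _ | simp
  · rw [finrank_nt, finrank_map_conjL, hV.dim]

/-! ## Theorem 1 (case of equality) -/

/-- **Gerstenhaber's theorem, case of equality** ([dSP13] Theorem 1, second half, `𝕂 = 𝕂₀`
commutative; Gerstenhaber 1958 for `#K ≥ n`, Serezhkin 1985 in general): a linear subspace of `Mat_n(K)`
consisting of nilpotent matrices and of the maximal dimension `binom(n, 2)` is similar to `NT_n(K)`: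
`V = P · NT_n(K) · P⁻¹` for a unit `P`, for every field `K` and every `n` (strong induction on `n`,
[dSP13] §4.1–§4.8). [cite: deSeguinsPazzis2013Gerstenhaber, Theorem 1 (case of equality), §4] -/
theorem exists_eq_nt_map_conjL :
    ∀ (n : ℕ) (V : Submodule K (Matrix (Fin n) (Fin n) K)), (∀ A ∈ V, IsNilpotent A) →
      Module.finrank K V = n.choose 2 →
      ∃ P : (Matrix (Fin n) (Fin n) K)ˣ,
        V = (nt K n).map (conjL P : Matrix (Fin n) (Fin n) K →ₗ[K] Matrix (Fin n) (Fin n) K) := by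
  intro n
  induction n using Nat.strong_induction_on with
  | _ n IH => ?_
  intro V hnil hdim
  rcases Nat.lt_or_ge n 2 with hn | hn
  · have hV : V = ⊥ := Submodule.finrank_eq_zero.1 (by rw [hdim]; exact Nat.choose_eq_zero_of_lt hn)
    have hnt : nt K n = ⊥ := Submodule.finrank_eq_zero.1 (by rw [finrank_nt]; exact Nat.choose_eq_zero_of_lt hn)
    exact ⟨1, by rw [hV, hnt, Submodule.map_bot]⟩
  · obtain ⟨m, rfl⟩ : ∃ m, n = m + 2 := ⟨n - 2, by omega⟩
    have IH' := IH (m + 1) (by omega)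
    obtain ⟨P₀, hV₀⟩ := exists_isPreNormalized hnil hdim IH'
    rcases Nat.eq_zero_or_pos m with rfl | hm
    · obtain ⟨P, hP⟩ := hV₀.two
      rw [map_conjL_map_conjL] at hP
      exact ⟨(P * P₀)⁻¹, by rw [← hP, map_conjL_inv_map_conjL]⟩
    · haveI : NeZero m := ⟨hm.ne'⟩
      obtain ⟨L, hV₁⟩ := hV₀.exists_isNormalized IH'
      obtain ⟨P, hP⟩ := hV₁.exists_map_conjL_eq_nt
      rw [map_conjL_map_conjL, map_conjL_map_conjL] at hP
      exact ⟨(P * bshear 0 L * P₀)⁻¹, by rw [← hP, map_conjL_inv_map_conjL]⟩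

end Core

/-- **Gerstenhaber's theorem, case of equality**, membership form: for some invertible `P`,
`A ∈ V ↔ P⁻¹ A P` is strictly upper-triangular. [cite: deSeguinsPazzis2013Gerstenhaber, Theorem 1 (case of equality)] -/
theorem exists_forall_mem_iff_mem_nt {n : ℕ} (V : Submodule K (Matrix (Fin n) (Fin n) K))
    (hV : ∀ A ∈ V, IsNilpotent A) (hdim : Module.finrank K V = n.choose 2) :
    ∃ P : (Matrix (Fin n) (Fin n) K)ˣ, ∀ A : Matrix (Fin n) (Fin n) K,
      A ∈ V ↔ ((P⁻¹ : (Matrix (Fin n) (Fin n) K)ˣ) : Matrix (Fin n) (Fin n) K) * A * P ∈ nt K n := by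
  obtain ⟨P, rfl⟩ := exists_eq_nt_map_conjL n V hV hdim
  exact ⟨P, fun A => by rw [mem_map_conjL_iff, conjL_symm_apply]⟩

/-! ## The discharge of the named fact -/

/-- **DISCHARGE of `deSeguinsPazzis2013_equality`** (Gerstenhaber's theorem, case of equality,
[dSP13] Theorem 1 second half, every field, every `n`): the named fact of
`GerstenhaberNilpotentSubspaceEquality.lean` HOLDS. [cite: deSeguinsPazzis2013Gerstenhaber, Theorem 1 (case of equality), §4] -/
theorem deSeguinsPazzis2013_equality_holds : deSeguinsPazzis2013_equality := by
  intro K _ n V hV hdim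
  obtain ⟨P, hP⟩ := exists_eq_nt_map_conjL n V hV hdim
  refine ⟨((P⁻¹ : (Matrix (Fin n) (Fin n) K)ˣ) : Matrix (Fin n) (Fin n) K), Units.isUnit _, fun A => ?_⟩
  rw [Matrix.inv_eq_left_inv (Units.mul_inv P), hP, mem_map_conjL_iff, conjL_symm_apply]
  rfl

end Literature.LinearAlgebra.Matrix.GerstenhaberNilpotentSubspace
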